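import Literature.AlgebraicGeometry.Motives.HodgeThetaSubalgebraUnitaryConstantRankLeviThree
import Literature.AlgebraicGeometry.Motives.HodgeThetaSubalgebraUnitaryNineElevenCore
import HarnessLib

/-!
# The `Θ`-subalgebra theorem for unitary multiplicities `(14, 15)` — the consecutive cell of `p = 29`, closed
# classification-free by six Levi-pair arguments (Ribet 1983 Thm. 3, Lie step; abelian 29-folds of type `(14, 15)`)

Family `hodge`, layer `Literature/AlgebraicGeometry/Motives` (pure linear algebra over `ℂ`; no geometry). Research
context: cell `pub-hodge-ring2` (HONEST FRAMING: research route conditional on HC_CM; not a corollary; Q11.4-sentence-2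
already refuted in dim ≥ 3), Literature lane gen 86, programme R74. UNCONDITIONAL; theorems only, no definition, no
named fact (D-0026), no `sorry`.

THE PRINT. K. A. Ribet, Amer. J. Math. 105 (1983), Thm. 3 = Gordon's survey Thm. 6.3 (3) [held
`paper:arxiv-alg-geom_9709030` p. 18]: `End⁰ = k` imaginary quadratic acting with coprime multiplicities `(n′, n″)` ⟹
`Hg = U(V, φ)`, `B•(Xⁿ) = D•(Xⁿ)`. The lane replaces Ribet's appeal to the classification of minuscule representations
pair by pair; `(14, 15)` is one of the two `p = 29` cells left open by R73 (README §HEIRS).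

THE ARGUMENT (`UnitaryFourteenFifteen.eq_top_of_smul`). Ranks `1, 2, 4, 7, 8, 11, 13, 14` are «good» (the larger-side
Levi types `(1|14)`, `(2|13)`, `(4|11)`, `(7|8)`, `(8|7)`, `(11|4)`, `(13|2)`, `(14|1)` are tree cores —
`UnitaryDoubleLevi.eq_top_of_raise_of_core`), so if `𝔊 ≠ End(W)` every raising operator has rank in
`S ⊆ {0, 3, 5, 6, 9, 10, 12}`. For a raising `B` of rank `r` let `ι` be its involution, `U⁺` of type `(14 − r | r)`,
`U⁻` of type `(r | 15 − r)`, `L^±` the concrete Levi algebras (`UnitaryLeviSetup.exists_levi_pair`), and for a raising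
`X` commuting with `ι` write `(i, j) = (rk X|_{U⁺}, rk X|_{U⁻})`, `i + j ∈ S`. Six steps:
* (G1) `9 ∉ S`: at `r = 9`, `L⁺` of type `(5|9)` is FULL (`UnitaryFive.eq_top`), and `j ∈ {1, 2, 4, 5}` is killed in
  `L⁻` of type `(9|6)` by the MIRRORED inner double Levi (`UnitaryDoubleLevi.eq_top_of_raise_of_core'`, cores
  `(1|8)`, `(2|7)`, `(4|5)`, `(5|4)`; a full `L⁻` gives rank `1` by `UnitaryLeviFull.exists_rankOne_raise_of_full`);
  the lift of a rank-one element of `L⁺` (`UnitaryLeviFull.exists_raise_lift`) has `i = 1`, `j ∈ {0, 3, 6}`,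
  `1 + j ∉ S`.
* (G2) `5 ∉ S`: at `r = 5`, `L⁺` of type `(9|5)` is full (`UnitaryNine.eq_top_of_smul`), `j ∈ {1, 3}` is killed in
  `L⁻` of type `(5|10)` (cores `(1|9)`, `(3|7)`), so `i = 2 ⟹ j = 4` and `i = 3 ⟹ j ≤ 2` — contradicting TOOL E
  (`UnitaryLeviPencil.false_of_full`, the pencil trick).
* (G3) `3 ∉ S`: the pencil of the `(11|3)` core (`UnitaryPencil.exists_pencil_of_core`) produces ranks `1 + m₀`,
  `2 + mᵢ` with `mᵢ ≤ 3`; `5 ∉ S` forces `m₁ = m₂ = m₃ = 1`, hence `m₀ ≤ 1`, but `1 + m₀ ∈ S` forces `m₀ = 2`.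
* (G4) `12 ∉ S`: at `r = 12`, `i ≤ 2`, `j ≤ 3`, `i + j ∈ S ∩ [1, 5] = ∅`, yet some `X` has `i ≥ 1`
  (`UnitaryLeviFull.exists_raise_commute_apply_ne_zero`).
* (G5) `10 ∉ S`: at `r = 10` (now maximal), `i = 1` is killed (`L⁺` of type `(4|10)` full by
  `UnitaryRankOneRaise.eq_top_of_rankOne_raise`, then `UnitaryLeviFull.exists_rankOne_raise_of_maxRank`), `j ∈ {1, 3}`
  by the mirrored double Levi in `L⁻` of type `(10|5)`; the profiles are `(0,0)`, `(2,4)`, `(4,2)`, the two non-zero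
  types cannot coexist (two pencils, `UnitaryGenericRank.exists_finrank_le_and_finrank_le`), and a single type is a
  Levi algebra of constant raising rank `2` — excluded by TOOL C (`UnitaryConstantRank.exists_raise_rank_ne_two`) on
  `L⁺`, resp. on the mirror of `L⁻` (adjoints, `UnitaryAdjointRank.finrank_range_eq`).
* (G6) `S = {0, 6}`: at `r = 6` (maximal), `j ∈ {1, 2, 4, 5}` is killed in `L⁻` of type `(6|9)`, `i = 3` in `L⁺` of
  type `(8|6)` (mirrored, core `(3|5)`); the profiles are `(0,0)`, `(0,6)`, `(6,0)`; some `X₀` has type `(6,0)`, two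
  pencils force `j = 0` for EVERY raising `X` commuting with `ι`, contradicting
  `UnitaryLeviFull.exists_raise_commute_apply_ne_zero` for `−ι`.
**`eq_top_of_smul'`** is the mirror `(15, 14)`. (`ℂ`-homogeneity of `s` enters only through the `(7|8)`, `(8|7)`,
`(9|5)` cores.) The six steps are separate theorems `UnitaryFourteenFifteen.no_rank_nine` … `false_of_rank_zero_or_six`
(§2), each taking the current list of admissible ranks as hypothesis `hS`; §1 collects the devices they share
(restriction to and lifting from a Levi algebra, raising pencils, «a full larger Levi algebra gives rank one», and the
mirrored TOOL C `UnitaryConstantRank.exists_raise_rank_ne_two'`).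

CONSEQUENCES (sequel under `HodgeTheory/`): Ribet's theorem at `(n′, n″) = (14, 15)`; the `p = 29` census residual
shrinks to `{10, 19}`.

## References
* [Ribet1983] K. A. Ribet, *Hodge classes on certain types of abelian varieties*, Amer. J. Math. 105 (1983), Thm. 3.
* [Gordon1997] B. B. Gordon, *A survey of the Hodge conjecture for abelian varieties*, Thm. 6.3 (3), pp. 18–19.
* [Deligne1982HodgeCycles] P. Deligne, *Hodge cycles on abelian varieties*, LNM 900 (1982), I §3 Prop. 3.4, 3.6.
* [GoodmanWallachGTM255] R. Goodman, N. R. Wallach, GTM 255 (2009), §4.1.1.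
* [Humphreys1972] J. E. Humphreys, *Introduction to Lie Algebras and Representation Theory*, §19.1.
* [HoffmanKunze1971LinearAlgebra] K. Hoffman, R. Kunze, *Linear Algebra* (1971), §3.1 Thm. 2, §6.7, §8.3.
-/

noncomputable section

open Module

namespace Literature.AlgebraicGeometry.Motives

namespace HodgeStructure

universe u

variable {W : Type u} [AddCommGroup W] [Module ℂ W]

/-! ### §1 Devices shared by the six steps -/

/-- **TOOL C, mirrored.** In the unitary setting with `3 ≤ dim Q < dim P`, `dim P ≥ 5`, the algebra `𝔊` contains a
non-zero RAISING operator of rank `≠ 2`: TOOL C (`UnitaryConstantRank.exists_raise_rank_ne_two`) for `−Θ` gives a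
lowering one, and its adjoint is raising of the same rank (`UnitaryAdjointRank.finrank_range_eq`).
[cite: Ribet1983, Thm. 3] [cite: GoodmanWallachGTM255, §4.1.1] [cite: HoffmanKunze1971LinearAlgebra, §8.3] -/
theorem UnitaryConstantRank.exists_raise_rank_ne_two' [FiniteDimensional ℂ W] {𝔊 : Submodule ℂ (Module.End ℂ W)}
    (hbr : ∀ Y ∈ 𝔊, ∀ Z ∈ 𝔊, Y * Z - Z * Y ∈ 𝔊)
    (hirr : ∀ U : Submodule ℂ W, (∀ A ∈ 𝔊, ∀ u ∈ U, A u ∈ U) → U = ⊥ ∨ U = ⊤)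
    {Θ : Module.End ℂ W} (hΘ : Θ ∈ 𝔊) (hΘΘ : Θ * Θ = 1)
    {P Q : Submodule ℂ W} (hP : ∀ x, x ∈ P ↔ Θ x = x) (hQ : ∀ x, x ∈ Q ↔ Θ x = -x)
    (hQ3 : 3 ≤ Module.finrank ℂ Q) (hba : Module.finrank ℂ Q < Module.finrank ℂ P) (hP5 : 5 ≤ Module.finrank ℂ P)
    {s : W → W → ℂ} (hadd : ∀ x y z, s (x + y) z = s x z + s y z) (hsymm : ∀ x y, s y x = starRingEnd ℂ (s x y))
    (hPQ : ∀ p ∈ P, ∀ q ∈ Q, s p q = 0) (hdefP : ∀ p ∈ P, s p p = 0 → p = 0) (hdefQ : ∀ q ∈ Q, s q q = 0 → q = 0)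
    (hadj : ∀ X ∈ 𝔊, ∃ Y ∈ 𝔊, ∀ x y, s (X x) y = s x (Y y)) :
    ∃ A ∈ 𝔊, Θ * A = A ∧ A * Θ = -A ∧ A ≠ 0 ∧ Module.finrank ℂ (LinearMap.range A) ≠ 2 := by
  have hnΘ : -Θ ∈ 𝔊 := Submodule.neg_mem _ hΘ
  have hnΘΘ : (-Θ) * (-Θ) = 1 := by rw [neg_mul_neg, hΘΘ]
  have hQ' : ∀ x, x ∈ Q ↔ (-Θ) x = x := fun x => by rw [hQ, LinearMap.neg_apply, neg_eq_iff_eq_neg]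
  have hP' : ∀ x, x ∈ P ↔ (-Θ) x = -x := fun x => by rw [hP, LinearMap.neg_apply, neg_inj]
  have hQP : ∀ q ∈ Q, ∀ p ∈ P, s q p = 0 := fun q hq p hp => by rw [hsymm, hPQ p hp q hq, map_zero]
  obtain ⟨A', hA', hΘA', hA'Θ, hA'ne, hA'2⟩ := UnitaryConstantRank.exists_raise_rank_ne_two hbr hirr hnΘ hnΘΘ hQ' hP'
    hQ3 hba hP5 hadd hsymm hQP hdefQ hdefP hadj
  obtain ⟨A, hA, hA'A⟩ := hadj A' hA'
  obtain ⟨hΘA, hAΘ⟩ := UnitaryTwoOdd.lower_of_adjoint hadd hsymm hnΘΘ hQ' hP' hQP hdefQ hdefP hΘA' hA'Θ hA'A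
  have hΘA₂ : Θ * A = A := by rw [neg_mul, neg_inj] at hΘA; exact hΘA
  have hAΘ₂ : A * Θ = -A := by rw [mul_neg, neg_eq_iff_eq_neg] at hAΘ; exact hAΘ
  have hvA' : ∀ v, A' v ∈ Q := fun v => (hQ' _).2 (by rw [← Module.End.mul_apply, hΘA'])
  have hvA : ∀ w, A w ∈ P := fun w => (hP _).2 (by rw [← Module.End.mul_apply, hΘA₂])
  have hrk := UnitaryAdjointRank.finrank_range_eq hadd hsymm hA'A (fun v h => hdefQ _ (hvA' v) h)
    (fun w h => hdefP _ (hvA w) h)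
  refine ⟨A, hA, hΘA₂, hAΘ₂, fun h0 => hA'ne ?_, by rw [← hrk]; exact hA'2⟩
  have h : Module.finrank ℂ (LinearMap.range A') = 0 := by rw [hrk, h0, LinearMap.range_zero, finrank_bot]
  exact LinearMap.range_eq_bot.1 (Submodule.finrank_eq_zero.1 h)

/-- The restriction of a raising `X ∈ 𝔊` commuting with `ι` to an `ι`-stable subspace `U` is a raising element of the
Levi algebra on `U`, of rank `dim X(U)`. [cite: GoodmanWallachGTM255, §4.1.1]
[cite: HoffmanKunze1971LinearAlgebra, §3.1 Thm. 2] -/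
theorem UnitaryLeviSetup.restrict_mem [FiniteDimensional ℂ W] {𝔊 : Submodule ℂ (Module.End ℂ W)}
    {Θ ι : Module.End ℂ W} {U : Submodule ℂ W} {L : Submodule ℂ (Module.End ℂ U)} {ιU : Module.End ℂ U}
    (hcU : ∀ Z : Module.End ℂ W, Z * ι = ι * Z → ∀ x ∈ U, Z x ∈ U)
    (hL : ∀ A, A ∈ L ↔ ∃ Z ∈ 𝔊, Z * ι = ι * Z ∧ ∀ x : U, ((A x : U) : W) = Z x)
    (hιU : ∀ x : U, ((ιU x : U) : W) = Θ x) (X : Module.End ℂ W) (hX : X ∈ 𝔊) (hΘX : Θ * X = X)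
    (hXΘ : X * Θ = -X) (hXc : X * ι = ι * X) :
    X.restrict (hcU X hXc) ∈ L ∧ ιU * X.restrict (hcU X hXc) = X.restrict (hcU X hXc) ∧
      X.restrict (hcU X hXc) * ιU = -X.restrict (hcU X hXc) ∧
      Module.finrank ℂ (LinearMap.range (X.restrict (hcU X hXc))) = Module.finrank ℂ (U.map X) := by
  have hval : ∀ v : U, ((X.restrict (hcU X hXc) v : U) : W) = X v := fun v => rfl
  refine ⟨(hL _).2 ⟨X, hX, hXc, hval⟩, LinearMap.ext fun v => Subtype.ext ?_,
    LinearMap.ext fun v => Subtype.ext ?_, UnitaryLeviRank.finrank_range_restrict _⟩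
  · rw [Module.End.mul_apply, hιU, hval, ← Module.End.mul_apply, hΘX]
  · rw [Module.End.mul_apply, LinearMap.neg_apply, Submodule.coe_neg, hval, hιU, ← Module.End.mul_apply, hXΘ,
      LinearMap.neg_apply, hval]

/-- A raising element `A` of the Levi algebra on `U` is the restriction of a raising `X ∈ 𝔊` commuting with `ι`, and
`dim X(U) = rk A` (`UnitaryLeviLift.exists_raise_restrict`). [cite: GoodmanWallachGTM255, §4.1.1]
[cite: HoffmanKunze1971LinearAlgebra, §3.1 Thm. 2] -/
theorem UnitaryLeviSetup.exists_lift [FiniteDimensional ℂ W] {𝔊 : Submodule ℂ (Module.End ℂ W)}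
    (hbr : ∀ Y ∈ 𝔊, ∀ Z ∈ 𝔊, Y * Z - Z * Y ∈ 𝔊) {Θ : Module.End ℂ W} (hΘ : Θ ∈ 𝔊) (hΘΘ : Θ * Θ = 1)
    {ι : Module.End ℂ W} {U : Submodule ℂ W} {L : Submodule ℂ (Module.End ℂ U)} {ιU : Module.End ℂ U}
    (hcU : ∀ Z : Module.End ℂ W, Z * ι = ι * Z → ∀ x ∈ U, Z x ∈ U) (hιΘ : ι * Θ = Θ * ι)
    (hL : ∀ A, A ∈ L ↔ ∃ Z ∈ 𝔊, Z * ι = ι * Z ∧ ∀ x : U, ((A x : U) : W) = Z x)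
    (hιU : ∀ x : U, ((ιU x : U) : W) = Θ x) (A : Module.End ℂ U) (hA : A ∈ L) (hιA : ιU * A = A)
    (hAι : A * ιU = -A) :
    ∃ X ∈ 𝔊, Θ * X = X ∧ X * Θ = -X ∧ X * ι = ι * X ∧
      Module.finrank ℂ (U.map X) = Module.finrank ℂ (LinearMap.range A) := by
  obtain ⟨Z, hZ, hZc, hAZ⟩ := (hL A).1 hA
  have hZ1 : ∀ u ∈ U, Θ (Z u) = Z u := fun u hu => by
    have h := congrArg (fun T => ((T ⟨u, hu⟩ : U) : W)) hιA
    simp only [Module.End.mul_apply, hιU, hAZ] at h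
    exact h
  have hZ2 : ∀ u ∈ U, Z (Θ u) = -(Z u) := fun u hu => by
    have h := congrArg (fun T => ((T ⟨u, hu⟩ : U) : W)) hAι
    simp only [Module.End.mul_apply, LinearMap.neg_apply, Submodule.coe_neg, hAZ] at h
    rw [hιU] at h
    exact h
  obtain ⟨X, hX, hΘX, hXΘ, hXc, hXZ⟩ := UnitaryLeviLift.exists_raise_restrict hbr hΘ hΘΘ hιΘ hZ hZc hZ1 hZ2
  have hxA : X.restrict (hcU X hXc) = A := LinearMap.ext fun v => Subtype.ext (by
    rw [LinearMap.coe_restrict_apply, hXZ v v.2, hAZ v])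
  exact ⟨X, hX, hΘX, hXΘ, hXc, by rw [← UnitaryLeviRank.finrank_range_restrict (hcU X hXc), hxA]⟩

/-- Raising pencils: `X + cX'` is a raising element of `𝔊` commuting with `ι` when `X` and `X'` are.
[cite: GoodmanWallachGTM255, §4.1.1] -/
theorem UnitaryLeviSetup.add_smul_raise {𝔊 : Submodule ℂ (Module.End ℂ W)} {Θ ι : Module.End ℂ W}
    (X : Module.End ℂ W) (hX : X ∈ 𝔊) (hΘX : Θ * X = X) (hXΘ : X * Θ = -X) (hXc : X * ι = ι * X)
    (X' : Module.End ℂ W) (hX' : X' ∈ 𝔊) (hΘX' : Θ * X' = X') (hX'Θ : X' * Θ = -X') (hX'c : X' * ι = ι * X')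
    (c : ℂ) :
    (X + c • X') ∈ 𝔊 ∧ Θ * (X + c • X') = X + c • X' ∧ (X + c • X') * Θ = -(X + c • X') ∧
      (X + c • X') * ι = ι * (X + c • X') :=
  ⟨Submodule.add_mem _ hX (Submodule.smul_mem _ _ hX'), by rw [mul_add, mul_smul_comm, hΘX, hΘX'],
    by rw [add_mul, smul_mul_assoc, hXΘ, hX'Θ, smul_neg, neg_add],
    by rw [add_mul, smul_mul_assoc, mul_add, mul_smul_comm, hXc, hX'c]⟩

/-- The rank of a pencil on an `ι`-stable subspace is the rank of the pencil of restrictions.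
[cite: HoffmanKunze1971LinearAlgebra, §3.1 Thm. 2] -/
theorem UnitaryLeviSetup.finrank_map_add_smul [FiniteDimensional ℂ W] {ι : Module.End ℂ W} {U : Submodule ℂ W}
    (hcU : ∀ Z : Module.End ℂ W, Z * ι = ι * Z → ∀ x ∈ U, Z x ∈ U) (X X' : Module.End ℂ W) (hXc : X * ι = ι * X)
    (hX'c : X' * ι = ι * X') (c : ℂ) (hc : (X + c • X') * ι = ι * (X + c • X')) :
    Module.finrank ℂ (U.map (X + c • X')) =
      Module.finrank ℂ (LinearMap.range (X.restrict (hcU X hXc) + c • X'.restrict (hcU X' hX'c))) := by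
  have hres : (X + c • X').restrict (hcU _ hc) = X.restrict (hcU X hXc) + c • X'.restrict (hcU X' hX'c) :=
    LinearMap.ext fun v => Subtype.ext (by
      simp only [LinearMap.coe_restrict_apply, LinearMap.add_apply, LinearMap.smul_apply, Submodule.coe_add,
        Submodule.coe_smul])
  rw [← UnitaryLeviRank.finrank_range_restrict (hcU _ hc), hres]

/-- A FULL Levi algebra on the larger side `U⁻` yields a raising operator of rank one
(`UnitaryLeviFull.exists_rankOne_raise_of_full`) — impossible once rank `1` is excluded. [cite: Ribet1983, Thm. 3]
[cite: GoodmanWallachGTM255, §4.1.1] -/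
theorem UnitaryLeviSetup.false_of_full_larger [FiniteDimensional ℂ W] {𝔊 : Submodule ℂ (Module.End ℂ W)}
    (hbr : ∀ Y ∈ 𝔊, ∀ Z ∈ 𝔊, Y * Z - Z * Y ∈ 𝔊) {Θ : Module.End ℂ W} (hΘΘ : Θ * Θ = 1) {Q : Submodule ℂ W}
    (hno1 : ∀ B' ∈ 𝔊, Θ * B' = B' → B' * Θ = -B' → Module.finrank ℂ (LinearMap.range B') ≠ 1)
    {ι : Module.End ℂ W} {Um Up : Submodule ℂ W} {Lm : Submodule ℂ (Module.End ℂ Um)} {B : Module.End ℂ W}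
    (hιι : ι * ι = 1) (hιΘ : ι * Θ = Θ * ι) (hUm : ∀ x, x ∈ Um ↔ ι x = -x) (hUp : ∀ x, x ∈ Up ↔ ι x = x)
    (h3 : 3 ≤ Module.finrank ℂ Um) (hab : Module.finrank ℂ Up < Module.finrank ℂ Um)
    (hPM : ∀ x, x ∈ LinearMap.range B ↔ ι x = -x ∧ Θ x = x)
    (hQM : ∀ x, x ∈ Q ⊓ LinearMap.ker B ↔ ι x = -x ∧ Θ x = -x)
    (hr0 : 0 < Module.finrank ℂ (LinearMap.range B)) (hq0 : 0 < Module.finrank ℂ ↥(Q ⊓ LinearMap.ker B))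
    (hLm : ∀ A, A ∈ Lm ↔ ∃ Z ∈ 𝔊, Z * ι = ι * Z ∧ ∀ x : Um, ((A x : Um) : W) = Z x) (hLmtop : Lm = ⊤) : False := by
  have hfullm : ∀ T : Module.End ℂ Um, ∃ Z ∈ 𝔊, Z * ι = ι * Z ∧ ∀ v : Um, ((T v : Um) : W) = Z v := fun T =>
    (hLm T).1 (by rw [hLmtop]; exact Submodule.mem_top)
  obtain ⟨⟨u, hu⟩, hu0⟩ := Module.finrank_pos_iff_exists_ne_zero.1 hr0
  have hu0' : u ≠ 0 := fun h => hu0 (Subtype.ext h)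
  obtain ⟨⟨q₀, hq₀⟩, hq₀0⟩ := Module.finrank_pos_iff_exists_ne_zero.1 hq0
  have hq₀0' : q₀ ≠ 0 := fun h => hq₀0 (Subtype.ext h)
  obtain ⟨B₁, hB₁, hΘB₁, hB₁Θ, hr1⟩ := UnitaryLeviFull.exists_rankOne_raise_of_full hbr hΘΘ hιι hιΘ hUm hUp hfullm h3
    hab ((hPM u).1 hu).2 ((hPM u).1 hu).1 hu0' ((hQM q₀).1 hq₀).2 ((hQM q₀).1 hq₀).1 hq₀0'
  exact hno1 B₁ hB₁ hΘB₁ hB₁Θ hr1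

/-! ### §2 The six steps -/

/-- (G1) If every raising operator has rank in `{0, 3, 5, 6, 9, 10, 12}`, none has rank `9` (module docstring).
[cite: Ribet1983, Thm. 3] [cite: Gordon1997, Thm. 6.3 (3)] [cite: GoodmanWallachGTM255, §4.1.1] -/
theorem UnitaryFourteenFifteen.no_rank_nine [FiniteDimensional ℂ W] {𝔊 : Submodule ℂ (Module.End ℂ W)}
    (hbr : ∀ Y ∈ 𝔊, ∀ Z ∈ 𝔊, Y * Z - Z * Y ∈ 𝔊)
    (hirr : ∀ U : Submodule ℂ W, (∀ A ∈ 𝔊, ∀ u ∈ U, A u ∈ U) → U = ⊥ ∨ U = ⊤)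
    {Θ : Module.End ℂ W} (hΘ : Θ ∈ 𝔊) (hΘΘ : Θ * Θ = 1)
    {P Q : Submodule ℂ W} (hP : ∀ x, x ∈ P ↔ Θ x = x) (hQ : ∀ x, x ∈ Q ↔ Θ x = -x)
    (hP14 : Module.finrank ℂ P = 14) (hQ15 : Module.finrank ℂ Q = 15)
    {s : W → W → ℂ} (hadd : ∀ x y z, s (x + y) z = s x z + s y z)
    (hsymm : ∀ x y, s y x = starRingEnd ℂ (s x y))
    (hPQ : ∀ p ∈ P, ∀ q ∈ Q, s p q = 0) (hdefP : ∀ p ∈ P, s p p = 0 → p = 0) (hdefQ : ∀ q ∈ Q, s q q = 0 → q = 0)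
    (hadj : ∀ X ∈ 𝔊, ∃ Y ∈ 𝔊, ∀ x y, s (X x) y = s x (Y y))
    (hS : ∀ B' ∈ 𝔊, Θ * B' = B' → B' * Θ = -B' →
      Module.finrank ℂ (LinearMap.range B') = 0 ∨ Module.finrank ℂ (LinearMap.range B') = 3 ∨
        Module.finrank ℂ (LinearMap.range B') = 5 ∨ Module.finrank ℂ (LinearMap.range B') = 6 ∨
        Module.finrank ℂ (LinearMap.range B') = 9 ∨ Module.finrank ℂ (LinearMap.range B') = 10 ∨
        Module.finrank ℂ (LinearMap.range B') = 12)
    {B : Module.End ℂ W} (hB : B ∈ 𝔊) (hΘB : Θ * B = B) (hBΘ : B * Θ = -B) (h9 : Module.finrank ℂ (LinearMap.range B) = 9) : False := by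
  classical
  have hΘΘv : ∀ v, Θ (Θ v) = v := fun v => by rw [← Module.End.mul_apply, hΘΘ, Module.End.one_apply]
  have hsU : ∀ U : Submodule ℂ W, ∀ x y z : U, s ((x + y : U) : W) z = s (x : W) z + s (y : W) z :=
    fun U x y z => by simp only [Submodule.coe_add, hadd]
  have hno1 : ∀ B' ∈ 𝔊, Θ * B' = B' → B' * Θ = -B' → Module.finrank ℂ (LinearMap.range B') ≠ 1 := by
    intro B' hB' hΘB' hB'Θ h1
    rcases hS B' hB' hΘB' hB'Θ with h | h | h | h | h | h | h <;> omega
  obtain ⟨ι, Um, Up, PU, QU, Lm, ιm, Pm, Qm, Lp, ιp, Pp, Qp, hιmem, hιι, hιΘ, hιs, hUm, hUp, hfinUm, hfinUp,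
    hPM, hQM, hPU, hQU, hrangeP, hPUP, hQUQ, hfinQM, hfinPU, hfinQU, hLm, hLp,
    hιmapply, hPmmem, hQmmem, hbrLm, hirrLm, hιmmem, hιmιm, hPm, hQm, hfinPm, hfinQm, hPmQm, hdefPm, hdefQm, hadjLm,
    hιpapply, hPpmem, hQpmem, hbrLp, hirrLp, hιpmem, hιpιp, hPp, hQp, hfinPp, hfinQp, hPpQp, hdefPp, hdefQp, hadjLp,
    hsplit⟩ :=
    UnitaryLeviSetup.exists_levi_pair hbr hirr hΘ hΘΘ hP hQ hadd hsymm hPQ hdefP hdefQ hadj hB hΘB hBΘ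
  rw [h9] at hfinQM hfinPU hfinQU hfinPm hfinQm hfinPp hfinQp hsplit
  rw [hQ15] at hfinQM hfinQm hfinUm
  rw [hP14] at hfinPU hfinPp hfinUp
  have hcm : ∀ Z : Module.End ℂ W, Z * ι = ι * Z → ∀ x ∈ Um, Z x ∈ Um := fun Z hZ x hx =>
    (hUm _).2 (by rw [← Module.End.mul_apply, ← hZ, Module.End.mul_apply, (hUm x).1 hx, map_neg])
  have hfullm_of : Lm = ⊤ → False := fun h =>
    UnitaryLeviSetup.false_of_full_larger hbr hΘΘ hno1 hιι hιΘ hUm hUp (by omega) (by omega) hPM hQM (by omega)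
      (by omega) hLm h
  -- mirrored kills in `L⁻` (type `(9 | 6)`): `j ∉ {1, 2, 4, 5}`
  have hkillm : ∀ X ∈ 𝔊, Θ * X = X → X * Θ = -X → X * ι = ι * X →
      Module.finrank ℂ (Um.map X) ≠ 1 ∧ Module.finrank ℂ (Um.map X) ≠ 2 ∧ Module.finrank ℂ (Um.map X) ≠ 4 ∧
        Module.finrank ℂ (Um.map X) ≠ 5 := by
    intro X hX hΘX hXΘ hXc
    obtain ⟨hxmem, hιmx, hxιm, hxrk⟩ := UnitaryLeviSetup.restrict_mem hcm hLm hιmapply X hX hΘX hXΘ hXc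
    have hk1 : Module.finrank ℂ (Um.map X) = 1 → False := fun hj => by
      rw [hj] at hxrk
      exact hfullm_of (UnitaryRankOneRaise.eq_top_of_rankOne_raise hbrLm hirrLm hιmmem hιmιm hPm hQm
        (s := fun v w : Um => s (v : W) w) (hsU Um) (fun v w => hsymm v w) hPmQm hdefPm hdefQm hadjLm hxmem hιmx hxιm
        hxrk (by omega) (by omega) (by omega))
    have hk : ∀ j, Module.finrank ℂ (Um.map X) = j → (j = 2 ∨ j = 4 ∨ j = 5) → False := by
      intro j hj hjs
      rw [hj] at hxrk
      refine hfullm_of (UnitaryDoubleLevi.eq_top_of_raise_of_core' hbrLm hirrLm hιmmem hιmιm hPm hQm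
        (s := fun v w : Um => s (v : W) w) (hsU Um) (fun v w => hsymm v w) hPmQm hdefPm hdefQm hadjLm hxmem hιmx hxιm
        (by rw [hxrk]; omega) (by omega) (by omega)
        fun U' 𝔩' ι' P' Q' hbr𝔩' hirr𝔩' hι' hι'ι' hP' hQ' hfinP' hfinQ' hP'Q' hdefP' hdefQ' hadj𝔩' => ?_)
      rw [hxrk] at hfinP' hfinQ'
      rw [hfinPm] at hfinQ'
      rcases hjs with rfl | rfl | rfl
      · -- `(2 | 7)`
        exact UnitaryTwoOdd.eq_top hbr𝔩' hirr𝔩' hι' hι'ι' hP' hQ' hfinP' ⟨3, by omega⟩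
          (s := fun v w : U' => s ((v : Um) : W) w) (fun v w z => by simp only [Submodule.coe_add, hadd])
          (fun v w => hsymm _ _) hP'Q' hdefP' hdefQ' hadj𝔩'
      · -- `(4 | 5)`
        exact UnitaryFourOdd.eq_top hbr𝔩' hirr𝔩' hι' hι'ι' hP' hQ' hfinP' ⟨2, by omega⟩
          (s := fun v w : U' => s ((v : Um) : W) w) (fun v w z => by simp only [Submodule.coe_add, hadd])
          (fun v w => hsymm _ _) hP'Q' hdefP' hdefQ' hadj𝔩'
      · -- `(5 | 4)`
        exact UnitaryFive.eq_top hbr𝔩' hirr𝔩' hι' hι'ι' hP' hQ' hfinP' (Or.inr (by omega))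
          (s := fun v w : U' => s ((v : Um) : W) w) (fun v w z => by simp only [Submodule.coe_add, hadd])
          (fun v w => hsymm _ _) hP'Q' hdefP' hdefQ' hadj𝔩'
    exact ⟨hk1, fun h => hk 2 h (by omega), fun h => hk 4 h (by omega), fun h => hk 5 h (by omega)⟩
  -- `L⁺` (type `(5 | 9)`) is full: the Five core
  have hLptop : Lp = ⊤ :=
    UnitaryFive.eq_top hbrLp hirrLp hιpmem hιpιp hPp hQp (by omega) (Or.inr (by omega))
      (s := fun v w : Up => s (v : W) w) (hsU Up) (fun v w => hsymm v w) hPpQp hdefPp hdefQp hadjLp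
  have hfullp : ∀ T : Module.End ℂ Up, ∃ Z ∈ 𝔊, Z * ι = ι * Z ∧ ∀ v : Up, ((T v : Up) : W) = Z v := fun T =>
    (hLp T).1 (by rw [hLptop]; exact Submodule.mem_top)
  -- a rank-one element of `L⁺` lifts to a raising `X` with `rk X|_{U⁺} = 1`
  obtain ⟨⟨e, he⟩, he0⟩ := Module.finrank_pos_iff_exists_ne_zero.1 (show 0 < Module.finrank ℂ PU by omega)
  have he0' : e ≠ 0 := fun h => he0 (Subtype.ext h)
  obtain ⟨⟨q₁, hq₁⟩, hq₁0⟩ := Module.finrank_pos_iff_exists_ne_zero.1 (show 0 < Module.finrank ℂ QU by omega)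
  have hq₁0' : q₁ ≠ 0 := fun h => hq₁0 (Subtype.ext h)
  obtain ⟨φ, hφ⟩ := Module.Projective.exists_dual_eq_one ℂ hq₁0'
  obtain ⟨X, hX, hΘX, hXΘ, hXc, hXv⟩ := UnitaryLeviFull.exists_raise_lift hbr hΘ hΘΘ hιΘ hUp hfullp φ ((hPU e).1 he).2
    ((hPU e).1 he).1
  have hkill : ∀ p, Θ p = p → X p = 0 := fun p hp => by
    have h : X p = -(X p) := by
      conv_lhs => rw [← hp, ← Module.End.mul_apply, hXΘ, LinearMap.neg_apply]
    have h2 : (2 : ℂ) • X p = 0 := by rw [two_smul]; nth_rewrite 2 [h]; rw [add_neg_cancel]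
    exact (smul_eq_zero.1 h2).resolve_left two_ne_zero
  have hUpX : Up.map X = ℂ ∙ e := by
    apply le_antisymm
    · rintro _ ⟨v, hv, rfl⟩
      have hv' : v = (2 : ℂ)⁻¹ • (v + Θ v) + (2 : ℂ)⁻¹ • (v - Θ v) := by module
      have hp : Θ ((2 : ℂ)⁻¹ • (v + Θ v)) = (2 : ℂ)⁻¹ • (v + Θ v) := by rw [map_smul, map_add, hΘΘv, add_comm]
      have hq : Θ ((2 : ℂ)⁻¹ • (v - Θ v)) = -((2 : ℂ)⁻¹ • (v - Θ v)) := by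
        rw [map_smul, map_sub, hΘΘv, ← smul_neg, neg_sub]
      have hιq : ι ((2 : ℂ)⁻¹ • (v - Θ v)) = (2 : ℂ)⁻¹ • (v - Θ v) := by
        rw [map_smul, map_sub, ← Module.End.mul_apply, hιΘ, Module.End.mul_apply, (hUp v).1 hv]
      rw [hv', map_add, hkill _ hp, zero_add, hXv _ hιq hq]
      exact Submodule.smul_mem _ _ (Submodule.mem_span_singleton_self e)
    · rw [Submodule.span_singleton_le_iff_mem]
      exact ⟨q₁, (hUp q₁).2 ((hQU q₁).1 hq₁).1, by rw [hXv q₁ ((hQU q₁).1 hq₁).1 ((hQU q₁).1 hq₁).2, hφ, one_smul]⟩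
  have hi1 : Module.finrank ℂ (Up.map X) = 1 := by rw [hUpX, finrank_span_singleton he0']
  obtain ⟨hs, -, -, -, hj⟩ := hsplit X hΘX hXΘ hXc
  obtain ⟨hm1, hm2, hm4, hm5⟩ := hkillm X hX hΘX hXΘ hXc
  have hr := hS X hX hΘX hXΘ
  rw [hs, hi1] at hr
  omega

/-- (G2) If every raising operator has rank in `{0, 3, 5, 6, 9, 10, 12}`, none has rank `5` (TOOL E; module
docstring). [cite: Ribet1983, Thm. 3] [cite: Gordon1997, Thm. 6.3 (3)] [cite: GoodmanWallachGTM255, §4.1.1] -/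
theorem UnitaryFourteenFifteen.no_rank_five [FiniteDimensional ℂ W] {𝔊 : Submodule ℂ (Module.End ℂ W)}
    (hbr : ∀ Y ∈ 𝔊, ∀ Z ∈ 𝔊, Y * Z - Z * Y ∈ 𝔊)
    (hirr : ∀ U : Submodule ℂ W, (∀ A ∈ 𝔊, ∀ u ∈ U, A u ∈ U) → U = ⊥ ∨ U = ⊤)
    {Θ : Module.End ℂ W} (hΘ : Θ ∈ 𝔊) (hΘΘ : Θ * Θ = 1)
    {P Q : Submodule ℂ W} (hP : ∀ x, x ∈ P ↔ Θ x = x) (hQ : ∀ x, x ∈ Q ↔ Θ x = -x)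
    (hP14 : Module.finrank ℂ P = 14) (hQ15 : Module.finrank ℂ Q = 15)
    {s : W → W → ℂ} (hadd : ∀ x y z, s (x + y) z = s x z + s y z)
    (hsmul : ∀ (c : ℂ) (x y : W), s (c • x) y = c * s x y)
    (hsymm : ∀ x y, s y x = starRingEnd ℂ (s x y))
    (hPQ : ∀ p ∈ P, ∀ q ∈ Q, s p q = 0) (hdefP : ∀ p ∈ P, s p p = 0 → p = 0) (hdefQ : ∀ q ∈ Q, s q q = 0 → q = 0)
    (hadj : ∀ X ∈ 𝔊, ∃ Y ∈ 𝔊, ∀ x y, s (X x) y = s x (Y y))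
    (hS : ∀ B' ∈ 𝔊, Θ * B' = B' → B' * Θ = -B' →
      Module.finrank ℂ (LinearMap.range B') = 0 ∨ Module.finrank ℂ (LinearMap.range B') = 3 ∨
        Module.finrank ℂ (LinearMap.range B') = 5 ∨ Module.finrank ℂ (LinearMap.range B') = 6 ∨
        Module.finrank ℂ (LinearMap.range B') = 9 ∨ Module.finrank ℂ (LinearMap.range B') = 10 ∨
        Module.finrank ℂ (LinearMap.range B') = 12)
    {B : Module.End ℂ W} (hB : B ∈ 𝔊) (hΘB : Θ * B = B) (hBΘ : B * Θ = -B) (h5 : Module.finrank ℂ (LinearMap.range B) = 5) : False := by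
  classical
  have hsU : ∀ U : Submodule ℂ W, ∀ x y z : U, s ((x + y : U) : W) z = s (x : W) z + s (y : W) z :=
    fun U x y z => by simp only [Submodule.coe_add, hadd]
  have hsmU : ∀ U : Submodule ℂ W, ∀ (c : ℂ) (x y : U), s ((c • x : U) : W) y = c * s (x : W) y :=
    fun U c x y => by simp only [Submodule.coe_smul, hsmul]
  have hno1 : ∀ B' ∈ 𝔊, Θ * B' = B' → B' * Θ = -B' → Module.finrank ℂ (LinearMap.range B') ≠ 1 := by
    intro B' hB' hΘB' hB'Θ h1
    rcases hS B' hB' hΘB' hB'Θ with h | h | h | h | h | h | h <;> omega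
  obtain ⟨ι, Um, Up, PU, QU, Lm, ιm, Pm, Qm, Lp, ιp, Pp, Qp, hιmem, hιι, hιΘ, hιs, hUm, hUp, hfinUm, hfinUp,
    hPM, hQM, hPU, hQU, hrangeP, hPUP, hQUQ, hfinQM, hfinPU, hfinQU, hLm, hLp,
    hιmapply, hPmmem, hQmmem, hbrLm, hirrLm, hιmmem, hιmιm, hPm, hQm, hfinPm, hfinQm, hPmQm, hdefPm, hdefQm, hadjLm,
    hιpapply, hPpmem, hQpmem, hbrLp, hirrLp, hιpmem, hιpιp, hPp, hQp, hfinPp, hfinQp, hPpQp, hdefPp, hdefQp, hadjLp,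
    hsplit⟩ :=
    UnitaryLeviSetup.exists_levi_pair hbr hirr hΘ hΘΘ hP hQ hadd hsymm hPQ hdefP hdefQ hadj hB hΘB hBΘ
  rw [h5] at hfinQM hfinPU hfinQU hfinPm hfinQm hfinPp hfinQp hsplit
  rw [hQ15] at hfinQM hfinQm hfinUm
  rw [hP14] at hfinPU hfinPp hfinUp
  have hcm : ∀ Z : Module.End ℂ W, Z * ι = ι * Z → ∀ x ∈ Um, Z x ∈ Um := fun Z hZ x hx =>
    (hUm _).2 (by rw [← Module.End.mul_apply, ← hZ, Module.End.mul_apply, (hUm x).1 hx, map_neg])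
  have hcp : ∀ Z : Module.End ℂ W, Z * ι = ι * Z → ∀ x ∈ Up, Z x ∈ Up := fun Z hZ x hx =>
    (hUp _).2 (by rw [← Module.End.mul_apply, ← hZ, Module.End.mul_apply, (hUp x).1 hx])
  have hfullm_of : Lm = ⊤ → False := fun h =>
    UnitaryLeviSetup.false_of_full_larger hbr hΘΘ hno1 hιι hιΘ hUm hUp (by omega) (by omega) hPM hQM (by omega)
      (by omega) hLm h
  -- kills in `L⁻` (type `(5 | 10)`): `j ∉ {1, 3}`
  have hkillm : ∀ X ∈ 𝔊, Θ * X = X → X * Θ = -X → X * ι = ι * X →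
      Module.finrank ℂ (Um.map X) ≠ 1 ∧ Module.finrank ℂ (Um.map X) ≠ 3 := by
    intro X hX hΘX hXΘ hXc
    obtain ⟨hxmem, hιmx, hxιm, hxrk⟩ := UnitaryLeviSetup.restrict_mem hcm hLm hιmapply X hX hΘX hXΘ hXc
    constructor
    · intro h1
      rw [h1] at hxrk
      exact hfullm_of (UnitaryRankOneRaise.eq_top_of_rankOne_raise hbrLm hirrLm hιmmem hιmιm hPm hQm
        (s := fun v w : Um => s (v : W) w) (hsU Um) (fun v w => hsymm v w) hPmQm hdefPm hdefQm hadjLm hxmem hιmx hxιm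
        hxrk (by omega) (by omega) (by omega))
    · intro h3
      rw [h3] at hxrk
      refine hfullm_of (UnitaryDoubleLevi.eq_top_of_raise_of_core hbrLm hirrLm hιmmem hιmιm hPm hQm
        (s := fun v w : Um => s (v : W) w) (hsU Um) (fun v w => hsymm v w) hPmQm hdefPm hdefQm hadjLm hxmem hιmx hxιm
        (by rw [hxrk]; norm_num) (by omega) (by omega)
        fun U' 𝔩' ι' P' Q' hbr𝔩' hirr𝔩' hι' hι'ι' hP' hQ' hfinP' hfinQ' hP'Q' hdefP' hdefQ' hadj𝔩' => ?_)
      rw [hxrk] at hfinP' hfinQ'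
      -- `(3 | 7)`
      exact UnitaryThreeCoprime.eq_top hbr𝔩' hirr𝔩' hι' hι'ι' hP' hQ' hfinP' (by omega)
        (s := fun v w : U' => s ((v : Um) : W) w) (fun v w z => by simp only [Submodule.coe_add, hadd])
        (fun v w => hsymm _ _) hP'Q' hdefP' hdefQ' hadj𝔩'
  -- `L⁺` (type `(9 | 5)`) is full: the Nine core
  have hLptop : Lp = ⊤ :=
    UnitaryNine.eq_top_of_smul hbrLp hirrLp hιpmem hιpιp hPp hQp (by omega) (by omega) (by omega) (by omega) (by omega)
      (s := fun v w : Up => s (v : W) w) (hsU Up) (hsmU Up) (fun v w => hsymm v w) hPpQp hdefPp hdefQp hadjLp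
  have hfullp : ∀ T : Module.End ℂ Up, ∃ Z ∈ 𝔊, Z * ι = ι * Z ∧ ∀ v : Up, ((T v : Up) : W) = Z v := fun T =>
    (hLp T).1 (by rw [hLptop]; exact Submodule.mem_top)
  -- the rules `i = 2 ⟹ j = 4`, `i = 3 ⟹ j ≤ 2` contradict TOOL E
  refine UnitaryLeviPencil.false_of_full hbr hΘ hΘΘ hιΘ hUm hUp hfullp hPU hQU (by omega) (by omega) 4
    (fun X hX hΘX hXΘ hXc hi2 => ?_) (fun X hX hΘX hXΘ hXc hi3 => ?_)
  · obtain ⟨hs, -, -, hj, -⟩ := hsplit X hΘX hXΘ hXc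
    obtain ⟨hm1, hm3⟩ := hkillm X hX hΘX hXΘ hXc
    have hr := hS X hX hΘX hXΘ
    rw [hs, hi2] at hr
    omega
  · obtain ⟨hs, -, -, hj, -⟩ := hsplit X hΘX hXΘ hXc
    obtain ⟨hm1, hm3⟩ := hkillm X hX hΘX hXΘ hXc
    have hr := hS X hX hΘX hXΘ
    rw [hs, hi3] at hr
    omega

/-- (G3) If every raising operator has rank in `{0, 3, 6, 10, 12}`, none has rank `3` (the pencil of the `(11|3)`
core; module docstring). [cite: Ribet1983, Thm. 3] [cite: Gordon1997, Thm. 6.3 (3)]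
[cite: HoffmanKunze1971LinearAlgebra, §3.1 Thm. 2] -/
theorem UnitaryFourteenFifteen.no_rank_three [FiniteDimensional ℂ W] {𝔊 : Submodule ℂ (Module.End ℂ W)}
    (hbr : ∀ Y ∈ 𝔊, ∀ Z ∈ 𝔊, Y * Z - Z * Y ∈ 𝔊)
    (hirr : ∀ U : Submodule ℂ W, (∀ A ∈ 𝔊, ∀ u ∈ U, A u ∈ U) → U = ⊥ ∨ U = ⊤)
    {Θ : Module.End ℂ W} (hΘ : Θ ∈ 𝔊) (hΘΘ : Θ * Θ = 1)
    {P Q : Submodule ℂ W} (hP : ∀ x, x ∈ P ↔ Θ x = x) (hQ : ∀ x, x ∈ Q ↔ Θ x = -x)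
    (hP14 : Module.finrank ℂ P = 14)
    {s : W → W → ℂ} (hadd : ∀ x y z, s (x + y) z = s x z + s y z)
    (hsymm : ∀ x y, s y x = starRingEnd ℂ (s x y))
    (hPQ : ∀ p ∈ P, ∀ q ∈ Q, s p q = 0) (hdefP : ∀ p ∈ P, s p p = 0 → p = 0) (hdefQ : ∀ q ∈ Q, s q q = 0 → q = 0)
    (hadj : ∀ X ∈ 𝔊, ∃ Y ∈ 𝔊, ∀ x y, s (X x) y = s x (Y y))
    (hS : ∀ B' ∈ 𝔊, Θ * B' = B' → B' * Θ = -B' →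
      Module.finrank ℂ (LinearMap.range B') = 0 ∨ Module.finrank ℂ (LinearMap.range B') = 3 ∨
        Module.finrank ℂ (LinearMap.range B') = 6 ∨ Module.finrank ℂ (LinearMap.range B') = 10 ∨
        Module.finrank ℂ (LinearMap.range B') = 12)
    {A : Module.End ℂ W} (hA : A ∈ 𝔊) (hΘA : Θ * A = A) (hAΘ : A * Θ = -A) (h3 : Module.finrank ℂ (LinearMap.range A) = 3) : False := by
  classical
  have hsU : ∀ U : Submodule ℂ W, ∀ x y z : U, s ((x + y : U) : W) z = s (x : W) z + s (y : W) z :=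
    fun U x y z => by simp only [Submodule.coe_add, hadd]
  have hpenmem : ∀ B₁ ∈ 𝔊, Θ * B₁ = B₁ → B₁ * Θ = -B₁ → ∀ B₂ ∈ 𝔊, Θ * B₂ = B₂ → B₂ * Θ = -B₂ → ∀ c : ℂ,
      B₁ + c • B₂ ∈ 𝔊 ∧ Θ * (B₁ + c • B₂) = B₁ + c • B₂ ∧ (B₁ + c • B₂) * Θ = -(B₁ + c • B₂) := by
    intro B₁ hB₁ hΘB₁ hB₁Θ B₂ hB₂ hΘB₂ hB₂Θ c
    exact ⟨Submodule.add_mem _ hB₁ (Submodule.smul_mem _ _ hB₂), by rw [mul_add, mul_smul_comm, hΘB₁, hΘB₂],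
      by rw [add_mul, smul_mul_assoc, hB₁Θ, hB₂Θ, smul_neg, neg_add]⟩
  obtain ⟨B₁, hB₁, B₂, hB₂, hΘB₁, hB₁Θ, hΘB₂, hB₂Θ, m₀, m₁, m₂, m₃, hm₀, hm₁, hm₂, hm₃, hr₁, hradd, hrsub, hr₂, himp⟩ :=
    UnitaryPencil.exists_pencil_of_core hbr hirr hΘ hΘΘ hP hQ hadd hsymm hPQ hdefP hdefQ hadj hA hΘA hAΘ (by omega)
      (by rw [hP14]; omega)
      fun U 𝔩 ι P' Q' hbr𝔩 hirr𝔩 hι hιι hP' hQ' hfinP' hfinQ' hP'Q' hdefP' hdefQ' hadj𝔩 => by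
        rw [h3, hP14] at hfinP'
        rw [h3] at hfinQ'
        exact UnitaryThreeCoprime.eq_top' hbr𝔩 hirr𝔩 hι hιι hP' hQ' (by omega) hfinQ'
          (s := fun x y : U => s (x : W) y) (hsU U) (fun x y => hsymm x y) hP'Q' hdefP' hdefQ' hadj𝔩
  rw [h3] at hm₀ hm₁ hm₂ hm₃
  have h₁ := hS B₁ hB₁ hΘB₁ hB₁Θ
  obtain ⟨hmadd, hΘadd, hΘadd'⟩ := hpenmem B₁ hB₁ hΘB₁ hB₁Θ B₂ hB₂ hΘB₂ hB₂Θ 1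
  obtain ⟨hmsub, hΘsub, hΘsub'⟩ := hpenmem B₁ hB₁ hΘB₁ hB₁Θ B₂ hB₂ hΘB₂ hB₂Θ (-1)
  obtain ⟨hm₂', hΘ₂, hΘ₂'⟩ := hpenmem B₁ hB₁ hΘB₁ hB₁Θ B₂ hB₂ hΘB₂ hB₂Θ 2
  rw [one_smul] at hmadd hΘadd hΘadd'
  rw [neg_one_smul, ← sub_eq_add_neg] at hmsub hΘsub hΘsub'
  have hkadd := hS _ hmadd hΘadd hΘadd'
  have hksub := hS _ hmsub hΘsub hΘsub'
  have h₂ := hS _ hm₂' hΘ₂ hΘ₂'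
  rw [hr₁] at h₁
  rw [hradd] at hkadd
  rw [hrsub] at hksub
  rw [hr₂] at h₂
  omega

/-- (G4) If every raising operator has rank in `{0, 6, 10, 12}`, none has rank `12` (module docstring).
[cite: Ribet1983, Thm. 3] [cite: GoodmanWallachGTM255, §4.1.1] -/
theorem UnitaryFourteenFifteen.no_rank_twelve [FiniteDimensional ℂ W] {𝔊 : Submodule ℂ (Module.End ℂ W)}
    (hbr : ∀ Y ∈ 𝔊, ∀ Z ∈ 𝔊, Y * Z - Z * Y ∈ 𝔊)
    (hirr : ∀ U : Submodule ℂ W, (∀ A ∈ 𝔊, ∀ u ∈ U, A u ∈ U) → U = ⊥ ∨ U = ⊤)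
    {Θ : Module.End ℂ W} (hΘ : Θ ∈ 𝔊) (hΘΘ : Θ * Θ = 1)
    {P Q : Submodule ℂ W} (hP : ∀ x, x ∈ P ↔ Θ x = x) (hQ : ∀ x, x ∈ Q ↔ Θ x = -x)
    (hP14 : Module.finrank ℂ P = 14) (hQ15 : Module.finrank ℂ Q = 15)
    {s : W → W → ℂ} (hadd : ∀ x y z, s (x + y) z = s x z + s y z)
    (hsymm : ∀ x y, s y x = starRingEnd ℂ (s x y))
    (hPQ : ∀ p ∈ P, ∀ q ∈ Q, s p q = 0) (hdefP : ∀ p ∈ P, s p p = 0 → p = 0) (hdefQ : ∀ q ∈ Q, s q q = 0 → q = 0)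
    (hadj : ∀ X ∈ 𝔊, ∃ Y ∈ 𝔊, ∀ x y, s (X x) y = s x (Y y))
    (hS : ∀ B' ∈ 𝔊, Θ * B' = B' → B' * Θ = -B' →
      Module.finrank ℂ (LinearMap.range B') = 0 ∨ Module.finrank ℂ (LinearMap.range B') = 6 ∨
        Module.finrank ℂ (LinearMap.range B') = 10 ∨ Module.finrank ℂ (LinearMap.range B') = 12)
    {B : Module.End ℂ W} (hB : B ∈ 𝔊) (hΘB : Θ * B = B) (hBΘ : B * Θ = -B) (h12 : Module.finrank ℂ (LinearMap.range B) = 12) : False := by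
  classical
  obtain ⟨ι, Um, Up, PU, QU, Lm, ιm, Pm, Qm, Lp, ιp, Pp, Qp, hιmem, hιι, hιΘ, hιs, hUm, hUp, hfinUm, hfinUp,
    hPM, hQM, hPU, hQU, hrangeP, hPUP, hQUQ, hfinQM, hfinPU, hfinQU, hLm, hLp,
    hιmapply, hPmmem, hQmmem, hbrLm, hirrLm, hιmmem, hιmιm, hPm, hQm, hfinPm, hfinQm, hPmQm, hdefPm, hdefQm, hadjLm,
    hιpapply, hPpmem, hQpmem, hbrLp, hirrLp, hιpmem, hιpιp, hPp, hQp, hfinPp, hfinQp, hPpQp, hdefPp, hdefQp, hadjLp,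
    hsplit⟩ :=
    UnitaryLeviSetup.exists_levi_pair hbr hirr hΘ hΘΘ hP hQ hadd hsymm hPQ hdefP hdefQ hadj hB hΘB hBΘ
  rw [h12] at hfinQM hfinPU hfinQU hfinPm hfinQm hfinPp hfinQp hsplit
  rw [hQ15] at hfinQM hfinQm hfinUm
  rw [hP14] at hfinPU hfinPp hfinUp
  have hcm : ∀ Z : Module.End ℂ W, Z * ι = ι * Z → ∀ x ∈ Um, Z x ∈ Um := fun Z hZ x hx =>
    (hUm _).2 (by rw [← Module.End.mul_apply, ← hZ, Module.End.mul_apply, (hUm x).1 hx, map_neg])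
  have hcp : ∀ Z : Module.End ℂ W, Z * ι = ι * Z → ∀ x ∈ Up, Z x ∈ Up := fun Z hZ x hx =>
    (hUp _).2 (by rw [← Module.End.mul_apply, ← hZ, Module.End.mul_apply, (hUp x).1 hx])
  obtain ⟨⟨p, hp⟩, hp0⟩ := Module.finrank_pos_iff_exists_ne_zero.1 (show 0 < Module.finrank ℂ PU by omega)
  obtain ⟨⟨q, hq⟩, hq0⟩ := Module.finrank_pos_iff_exists_ne_zero.1 (show 0 < Module.finrank ℂ QU by omega)
  obtain ⟨X₀, hX₀, hΘX₀, hX₀Θ, hX₀c, c, hιc, hΘc, hX₀c0⟩ :=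
    UnitaryLeviFull.exists_raise_commute_apply_ne_zero hbr hirr hΘ hΘΘ hQ hιmem hιι hιΘ hUm hUp
      ⟨p, fun h => hp0 (Subtype.ext h), ((hPU p).1 hp).1, ((hPU p).1 hp).2⟩
      ⟨q, fun h => hq0 (Subtype.ext h), ((hQU q).1 hq).1, ((hQU q).1 hq).2⟩
  obtain ⟨hs, hi, -, -, hj⟩ := hsplit X₀ hΘX₀ hX₀Θ hX₀c
  have hr := hS X₀ hX₀ hΘX₀ hX₀Θ
  rw [hs] at hr
  have hi0 : Module.finrank ℂ (Up.map X₀) = 0 := by omega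
  have hmem : X₀ c ∈ Up.map X₀ := Submodule.mem_map_of_mem ((hUp c).2 hιc)
  rw [Submodule.finrank_eq_zero.1 hi0, Submodule.mem_bot] at hmem
  exact hX₀c0 hmem

/-- (G5) If every raising operator has rank in `{0, 6, 10}`, none has rank `10` (two pencils and TOOL C on both Levi
algebras; module docstring). [cite: Ribet1983, Thm. 3] [cite: Gordon1997, Thm. 6.3 (3)]
[cite: GoodmanWallachGTM255, §4.1.1] -/
theorem UnitaryFourteenFifteen.no_rank_ten [FiniteDimensional ℂ W] {𝔊 : Submodule ℂ (Module.End ℂ W)}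
    (hbr : ∀ Y ∈ 𝔊, ∀ Z ∈ 𝔊, Y * Z - Z * Y ∈ 𝔊)
    (hirr : ∀ U : Submodule ℂ W, (∀ A ∈ 𝔊, ∀ u ∈ U, A u ∈ U) → U = ⊥ ∨ U = ⊤)
    {Θ : Module.End ℂ W} (hΘ : Θ ∈ 𝔊) (hΘΘ : Θ * Θ = 1)
    {P Q : Submodule ℂ W} (hP : ∀ x, x ∈ P ↔ Θ x = x) (hQ : ∀ x, x ∈ Q ↔ Θ x = -x)
    (hP14 : Module.finrank ℂ P = 14) (hQ15 : Module.finrank ℂ Q = 15)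
    {s : W → W → ℂ} (hadd : ∀ x y z, s (x + y) z = s x z + s y z)
    (hsymm : ∀ x y, s y x = starRingEnd ℂ (s x y))
    (hPQ : ∀ p ∈ P, ∀ q ∈ Q, s p q = 0) (hdefP : ∀ p ∈ P, s p p = 0 → p = 0) (hdefQ : ∀ q ∈ Q, s q q = 0 → q = 0)
    (hadj : ∀ X ∈ 𝔊, ∃ Y ∈ 𝔊, ∀ x y, s (X x) y = s x (Y y))
    (hS : ∀ B' ∈ 𝔊, Θ * B' = B' → B' * Θ = -B' →
      Module.finrank ℂ (LinearMap.range B') = 0 ∨ Module.finrank ℂ (LinearMap.range B') = 6 ∨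
        Module.finrank ℂ (LinearMap.range B') = 10)
    {B : Module.End ℂ W} (hB : B ∈ 𝔊) (hΘB : Θ * B = B) (hBΘ : B * Θ = -B) (h10 : Module.finrank ℂ (LinearMap.range B) = 10) : False := by
  classical
  have hsU : ∀ U : Submodule ℂ W, ∀ x y z : U, s ((x + y : U) : W) z = s (x : W) z + s (y : W) z :=
    fun U x y z => by simp only [Submodule.coe_add, hadd]
  have hno1 : ∀ B' ∈ 𝔊, Θ * B' = B' → B' * Θ = -B' → Module.finrank ℂ (LinearMap.range B') ≠ 1 := by
    intro B' hB' hΘB' hB'Θ h1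
    rcases hS B' hB' hΘB' hB'Θ with h | h | h <;> omega
  have hmax : ∀ B' ∈ 𝔊, Θ * B' = B' → B' * Θ = -B' →
      Module.finrank ℂ (LinearMap.range B') ≤ Module.finrank ℂ (LinearMap.range B) := by
    intro B' hB' hΘB' hB'Θ
    rcases hS B' hB' hΘB' hB'Θ with h | h | h <;> omega
  obtain ⟨ι, Um, Up, PU, QU, Lm, ιm, Pm, Qm, Lp, ιp, Pp, Qp, hιmem, hιι, hιΘ, hιs, hUm, hUp, hfinUm, hfinUp,
    hPM, hQM, hPU, hQU, hrangeP, hPUP, hQUQ, hfinQM, hfinPU, hfinQU, hLm, hLp,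
    hιmapply, hPmmem, hQmmem, hbrLm, hirrLm, hιmmem, hιmιm, hPm, hQm, hfinPm, hfinQm, hPmQm, hdefPm, hdefQm, hadjLm,
    hιpapply, hPpmem, hQpmem, hbrLp, hirrLp, hιpmem, hιpιp, hPp, hQp, hfinPp, hfinQp, hPpQp, hdefPp, hdefQp, hadjLp,
    hsplit⟩ :=
    UnitaryLeviSetup.exists_levi_pair hbr hirr hΘ hΘΘ hP hQ hadd hsymm hPQ hdefP hdefQ hadj hB hΘB hBΘ
  rw [h10] at hfinQM hfinPU hfinQU hfinPm hfinQm hfinPp hfinQp hsplit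
  rw [hQ15] at hfinQM hfinQm hfinUm
  rw [hP14] at hfinPU hfinPp hfinUp
  have hcm : ∀ Z : Module.End ℂ W, Z * ι = ι * Z → ∀ x ∈ Um, Z x ∈ Um := fun Z hZ x hx =>
    (hUm _).2 (by rw [← Module.End.mul_apply, ← hZ, Module.End.mul_apply, (hUm x).1 hx, map_neg])
  have hcp : ∀ Z : Module.End ℂ W, Z * ι = ι * Z → ∀ x ∈ Up, Z x ∈ Up := fun Z hZ x hx =>
    (hUp _).2 (by rw [← Module.End.mul_apply, ← hZ, Module.End.mul_apply, (hUp x).1 hx])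
  have hfullm_of : Lm = ⊤ → False := fun h =>
    UnitaryLeviSetup.false_of_full_larger hbr hΘΘ hno1 hιι hιΘ hUm hUp (by omega) (by omega) hPM hQM (by omega)
      (by omega) hLm h
  -- a full `L⁺` is impossible too (`B` has maximal rank)
  have hfullp_of : Lp = ⊤ → False := by
    intro hLptop
    have hfullp : ∀ T : Module.End ℂ Up, ∃ Z ∈ 𝔊, Z * ι = ι * Z ∧ ∀ v : Up, ((T v : Up) : W) = Z v := fun T =>
      (hLp T).1 (by rw [hLptop]; exact Submodule.mem_top)
    obtain ⟨e₁, he₁, e₂, he₂, he₁0, he₂1⟩ := UnitaryPencil.exists_pair_of_two_le_finrank PU (by omega)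
    have hind : ∀ a b : ℂ, a • e₁ + b • e₂ = 0 → a = 0 ∧ b = 0 := by
      intro a b hab
      by_cases hb : b = 0
      · rw [hb, zero_smul, add_zero] at hab
        exact ⟨(smul_eq_zero.1 hab).resolve_right he₁0, hb⟩
      · exfalso
        apply he₂1
        rw [Submodule.mem_span_singleton]
        refine ⟨-(b⁻¹ * a), ?_⟩
        have : e₂ = b⁻¹ • (b • e₂) := by rw [smul_smul, inv_mul_cancel₀ hb, one_smul]
        rw [this, eq_neg_of_add_eq_zero_right hab]
        module
    obtain ⟨⟨c₁, hc₁⟩, hc₁0⟩ := Module.finrank_pos_iff_exists_ne_zero.1 (show 0 < Module.finrank ℂ QU by omega)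
    obtain ⟨B₁, hB₁, hΘB₁, hB₁Θ, hr1⟩ := UnitaryLeviFull.exists_rankOne_raise_of_maxRank hbr hΘ hΘΘ hB hΘB hBΘ hmax hιι
      hιΘ (fun w => ((hPM _).1 (LinearMap.mem_range_self B w)).1)
      (fun v hιv hΘv => LinearMap.mem_ker.1 (Submodule.mem_inf.1 ((hQM v).2 ⟨hιv, hΘv⟩)).2)
      (fun v hΘv hBv => ((hQM v).1 (Submodule.mem_inf.2 ⟨(hQ v).2 hΘv, LinearMap.mem_ker.2 hBv⟩)).1) hUp hfullp
      ((hPU e₁).1 he₁).2 ((hPU e₁).1 he₁).1 ((hPU e₂).1 he₂).2 ((hPU e₂).1 he₂).1 hind ((hQU c₁).1 hc₁).2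
      ((hQU c₁).1 hc₁).1 (fun h => hc₁0 (Subtype.ext h))
    exact hno1 B₁ hB₁ hΘB₁ hB₁Θ hr1
  -- kills: `i ≠ 1` (`L⁺` of type `(4 | 10)`), `j ∉ {1, 3}` (`L⁻` of type `(10 | 5)`, mirrored for `j = 3`)
  have hkillp1 : ∀ X ∈ 𝔊, Θ * X = X → X * Θ = -X → X * ι = ι * X → Module.finrank ℂ (Up.map X) ≠ 1 := by
    intro X hX hΘX hXΘ hXc h1
    obtain ⟨hymem, hιpy, hyιp, hyrk⟩ := UnitaryLeviSetup.restrict_mem hcp hLp hιpapply X hX hΘX hXΘ hXc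
    rw [h1] at hyrk
    exact hfullp_of (UnitaryRankOneRaise.eq_top_of_rankOne_raise hbrLp hirrLp hιpmem hιpιp hPp hQp
      (s := fun v w : Up => s (v : W) w) (hsU Up) (fun v w => hsymm v w) hPpQp hdefPp hdefQp hadjLp hymem hιpy hyιp
      hyrk (by omega) (by omega) (by omega))
  have hkillm : ∀ X ∈ 𝔊, Θ * X = X → X * Θ = -X → X * ι = ι * X →
      Module.finrank ℂ (Um.map X) ≠ 1 ∧ Module.finrank ℂ (Um.map X) ≠ 3 := by
    intro X hX hΘX hXΘ hXc
    obtain ⟨hxmem, hιmx, hxιm, hxrk⟩ := UnitaryLeviSetup.restrict_mem hcm hLm hιmapply X hX hΘX hXΘ hXc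
    constructor
    · intro h1
      rw [h1] at hxrk
      exact hfullm_of (UnitaryRankOneRaise.eq_top_of_rankOne_raise hbrLm hirrLm hιmmem hιmιm hPm hQm
        (s := fun v w : Um => s (v : W) w) (hsU Um) (fun v w => hsymm v w) hPmQm hdefPm hdefQm hadjLm hxmem hιmx hxιm
        hxrk (by omega) (by omega) (by omega))
    · intro h3
      rw [h3] at hxrk
      refine hfullm_of (UnitaryDoubleLevi.eq_top_of_raise_of_core' hbrLm hirrLm hιmmem hιmιm hPm hQm
        (s := fun v w : Um => s (v : W) w) (hsU Um) (fun v w => hsymm v w) hPmQm hdefPm hdefQm hadjLm hxmem hιmx hxιm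
        (by rw [hxrk]; norm_num) (by omega) (by omega)
        fun U' 𝔩' ι' P' Q' hbr𝔩' hirr𝔩' hι' hι'ι' hP' hQ' hfinP' hfinQ' hP'Q' hdefP' hdefQ' hadj𝔩' => ?_)
      rw [hxrk] at hfinP' hfinQ'
      rw [hfinPm] at hfinQ'
      -- `(3 | 7)`
      exact UnitaryThreeCoprime.eq_top hbr𝔩' hirr𝔩' hι' hι'ι' hP' hQ' hfinP' (by omega)
        (s := fun v w : U' => s ((v : Um) : W) w) (fun v w z => by simp only [Submodule.coe_add, hadd])
        (fun v w => hsymm _ _) hP'Q' hdefP' hdefQ' hadj𝔩'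
  -- the profiles are `(0, 0)`, `(2, 4)`, `(4, 2)`
  have hprof : ∀ X ∈ 𝔊, Θ * X = X → X * Θ = -X → X * ι = ι * X →
      (Module.finrank ℂ (Up.map X) = 0 ∧ Module.finrank ℂ (Um.map X) = 0) ∨
        (Module.finrank ℂ (Up.map X) = 2 ∧ Module.finrank ℂ (Um.map X) = 4) ∨
        (Module.finrank ℂ (Up.map X) = 4 ∧ Module.finrank ℂ (Um.map X) = 2) := by
    intro X hX hΘX hXΘ hXc
    obtain ⟨hs, hi, hi', hj, hj'⟩ := hsplit X hΘX hXΘ hXc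
    have h1 := hkillp1 X hX hΘX hXΘ hXc
    obtain ⟨hm1, hm3⟩ := hkillm X hX hΘX hXΘ hXc
    have hr := hS X hX hΘX hXΘ
    rw [hs] at hr
    omega
  -- the two non-zero types do not coexist (two pencils)
  have hnotboth : ∀ X ∈ 𝔊, Θ * X = X → X * Θ = -X → X * ι = ι * X → ∀ X' ∈ 𝔊, Θ * X' = X' → X' * Θ = -X' →
      X' * ι = ι * X' → Module.finrank ℂ (Up.map X) = 2 → Module.finrank ℂ (Up.map X') = 4 → False := by
    intro X hX hΘX hXΘ hXc X' hX' hΘX' hX'Θ hX'c h2 h4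
    have hj4 : Module.finrank ℂ (Um.map X) = 4 := by
      rcases hprof X hX hΘX hXΘ hXc with h | h | h <;> omega
    obtain ⟨c, hc1, hc2⟩ := UnitaryGenericRank.exists_finrank_le_and_finrank_le (X'.restrict (hcp X' hX'c))
      (X.restrict (hcp X hXc)) (X.restrict (hcm X hXc)) (X'.restrict (hcm X' hX'c))
    obtain ⟨hX₁, hΘX₁, hX₁Θ, hX₁c⟩ := UnitaryLeviSetup.add_smul_raise X hX hΘX hXΘ hXc X' hX' hΘX' hX'Θ hX'c c
    have hi₁ := UnitaryLeviSetup.finrank_map_add_smul hcp X X' hXc hX'c c hX₁c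
    have hj₁ := UnitaryLeviSetup.finrank_map_add_smul hcm X X' hXc hX'c c hX₁c
    have hy' : Module.finrank ℂ (LinearMap.range (X'.restrict (hcp X' hX'c))) = 4 := by
      rw [UnitaryLeviRank.finrank_range_restrict, h4]
    have hx : Module.finrank ℂ (LinearMap.range (X.restrict (hcm X hXc))) = 4 := by
      rw [UnitaryLeviRank.finrank_range_restrict, hj4]
    have hp := hprof (X + c • X') hX₁ hΘX₁ hX₁Θ hX₁c
    rw [hi₁, hj₁] at hp
    omega
  -- some `X₀` moves `U⁺`
  obtain ⟨⟨p, hp⟩, hp0⟩ := Module.finrank_pos_iff_exists_ne_zero.1 (show 0 < Module.finrank ℂ PU by omega)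
  obtain ⟨⟨q, hq⟩, hq0⟩ := Module.finrank_pos_iff_exists_ne_zero.1 (show 0 < Module.finrank ℂ QU by omega)
  obtain ⟨X₀, hX₀, hΘX₀, hX₀Θ, hX₀c, c, hιc, hΘc, hX₀c0⟩ :=
    UnitaryLeviFull.exists_raise_commute_apply_ne_zero hbr hirr hΘ hΘΘ hQ hιmem hιι hιΘ hUm hUp
      ⟨p, fun h => hp0 (Subtype.ext h), ((hPU p).1 hp).1, ((hPU p).1 hp).2⟩
      ⟨q, fun h => hq0 (Subtype.ext h), ((hQU q).1 hq).1, ((hQU q).1 hq).2⟩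
  have hX₀i : Module.finrank ℂ (Up.map X₀) ≠ 0 := fun h0 => by
    have hmem : X₀ c ∈ Up.map X₀ := Submodule.mem_map_of_mem ((hUp c).2 hιc)
    rw [Submodule.finrank_eq_zero.1 h0, Submodule.mem_bot] at hmem
    exact hX₀c0 hmem
  rcases hprof X₀ hX₀ hΘX₀ hX₀Θ hX₀c with ⟨hi0, -⟩ | ⟨hi2, -⟩ | ⟨hi4, -⟩
  · exact hX₀i hi0
  · -- every profile is `(0,0)` or `(2,4)`: `L⁺` (type `(4 | 10)`) has constant raising rank `2` — TOOL C
    obtain ⟨A, hA, hιpA, hAιp, hAne, hA2⟩ :=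
      UnitaryConstantRank.exists_raise_rank_ne_two hbrLp hirrLp hιpmem hιpιp hPp hQp (by omega) (by omega) (by omega)
        (s := fun v w : Up => s (v : W) w) (hsU Up) (fun v w => hsymm v w) hPpQp hdefPp hdefQp hadjLp
    obtain ⟨X, hX, hΘX, hXΘ, hXc, hXUp⟩ := UnitaryLeviSetup.exists_lift hbr hΘ hΘΘ hcp hιΘ hLp hιpapply A hA hιpA hAιp
    have hA0 : Module.finrank ℂ (LinearMap.range A) ≠ 0 := fun h =>
      hAne (LinearMap.range_eq_bot.1 (Submodule.finrank_eq_zero.1 h))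
    rcases hprof X hX hΘX hXΘ hXc with ⟨h, -⟩ | ⟨h, -⟩ | ⟨h, -⟩
    · exact hA0 (hXUp ▸ h)
    · exact hA2 (hXUp ▸ h)
    · exact hnotboth X₀ hX₀ hΘX₀ hX₀Θ hX₀c X hX hΘX hXΘ hXc hi2 h
  · -- every profile is `(0,0)` or `(4,2)`: `L⁻` (type `(10 | 5)`) has constant raising rank `2` — mirrored TOOL C
    obtain ⟨A, hA, hιmA, hAιm, hAne, hA2⟩ :=
      UnitaryConstantRank.exists_raise_rank_ne_two' hbrLm hirrLm hιmmem hιmιm hPm hQm (by omega) (by omega)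
        (by omega) (s := fun v w : Um => s (v : W) w) (hsU Um) (fun v w => hsymm v w) hPmQm hdefPm hdefQm hadjLm
    obtain ⟨X, hX, hΘX, hXΘ, hXc, hXUm⟩ := UnitaryLeviSetup.exists_lift hbr hΘ hΘΘ hcm hιΘ hLm hιmapply A hA hιmA hAιm
    have hA0 : Module.finrank ℂ (LinearMap.range A) ≠ 0 := fun h =>
      hAne (LinearMap.range_eq_bot.1 (Submodule.finrank_eq_zero.1 h))
    rcases hprof X hX hΘX hXΘ hXc with ⟨-, h⟩ | ⟨h', -⟩ | ⟨-, h⟩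
    · exact hA0 (hXUm ▸ h)
    · exact hnotboth X hX hΘX hXΘ hXc X₀ hX₀ hΘX₀ hX₀Θ hX₀c h' hi4
    · exact hA2 (hXUm ▸ h)

/-- (G6) The residual case: the raising ranks cannot all lie in `{0, 6}` (two pencils at a maximal raising operator;
module docstring). [cite: Ribet1983, Thm. 3] [cite: Gordon1997, Thm. 6.3 (3)] [cite: GoodmanWallachGTM255, §4.1.1] -/
theorem UnitaryFourteenFifteen.false_of_rank_zero_or_six [FiniteDimensional ℂ W] {𝔊 : Submodule ℂ (Module.End ℂ W)}
    (hbr : ∀ Y ∈ 𝔊, ∀ Z ∈ 𝔊, Y * Z - Z * Y ∈ 𝔊)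
    (hirr : ∀ U : Submodule ℂ W, (∀ A ∈ 𝔊, ∀ u ∈ U, A u ∈ U) → U = ⊥ ∨ U = ⊤)
    {Θ : Module.End ℂ W} (hΘ : Θ ∈ 𝔊) (hΘΘ : Θ * Θ = 1)
    {P Q : Submodule ℂ W} (hP : ∀ x, x ∈ P ↔ Θ x = x) (hQ : ∀ x, x ∈ Q ↔ Θ x = -x)
    (hP14 : Module.finrank ℂ P = 14) (hQ15 : Module.finrank ℂ Q = 15)
    {s : W → W → ℂ} (hadd : ∀ x y z, s (x + y) z = s x z + s y z)
    (hsymm : ∀ x y, s y x = starRingEnd ℂ (s x y))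
    (hPQ : ∀ p ∈ P, ∀ q ∈ Q, s p q = 0) (hdefP : ∀ p ∈ P, s p p = 0 → p = 0) (hdefQ : ∀ q ∈ Q, s q q = 0 → q = 0)
    (hadj : ∀ X ∈ 𝔊, ∃ Y ∈ 𝔊, ∀ x y, s (X x) y = s x (Y y))
    (hS : ∀ B' ∈ 𝔊, Θ * B' = B' → B' * Θ = -B' →
      Module.finrank ℂ (LinearMap.range B') = 0 ∨ Module.finrank ℂ (LinearMap.range B') = 6) : False := by
  classical
  have hsU : ∀ U : Submodule ℂ W, ∀ x y z : U, s ((x + y : U) : W) z = s (x : W) z + s (y : W) z :=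
    fun U x y z => by simp only [Submodule.coe_add, hadd]
  have hno1 : ∀ B' ∈ 𝔊, Θ * B' = B' → B' * Θ = -B' → Module.finrank ℂ (LinearMap.range B') ≠ 1 := by
    intro B' hB' hΘB' hB'Θ h1
    rcases hS B' hB' hΘB' hB'Θ with h | h <;> omega
  obtain ⟨B, hB, hΘB, hBΘ, hr2⟩ :=
    UnitaryThreeCoprime.exists_raise_rank_ge_two hbr hirr hΘ hΘΘ hP hQ (by omega) (by omega)
  have h6 : Module.finrank ℂ (LinearMap.range B) = 6 := by
    rcases hS B hB hΘB hBΘ with h | h <;> omega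
  have hmax : ∀ B' ∈ 𝔊, Θ * B' = B' → B' * Θ = -B' →
      Module.finrank ℂ (LinearMap.range B') ≤ Module.finrank ℂ (LinearMap.range B) := by
    intro B' hB' hΘB' hB'Θ
    rcases hS B' hB' hΘB' hB'Θ with h | h <;> omega
  obtain ⟨ι, Um, Up, PU, QU, Lm, ιm, Pm, Qm, Lp, ιp, Pp, Qp, hιmem, hιι, hιΘ, hιs, hUm, hUp, hfinUm, hfinUp,
    hPM, hQM, hPU, hQU, hrangeP, hPUP, hQUQ, hfinQM, hfinPU, hfinQU, hLm, hLp,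
    hιmapply, hPmmem, hQmmem, hbrLm, hirrLm, hιmmem, hιmιm, hPm, hQm, hfinPm, hfinQm, hPmQm, hdefPm, hdefQm, hadjLm,
    hιpapply, hPpmem, hQpmem, hbrLp, hirrLp, hιpmem, hιpιp, hPp, hQp, hfinPp, hfinQp, hPpQp, hdefPp, hdefQp, hadjLp,
    hsplit⟩ :=
    UnitaryLeviSetup.exists_levi_pair hbr hirr hΘ hΘΘ hP hQ hadd hsymm hPQ hdefP hdefQ hadj hB hΘB hBΘ
  rw [h6] at hfinQM hfinPU hfinQU hfinPm hfinQm hfinPp hfinQp hsplit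
  rw [hQ15] at hfinQM hfinQm hfinUm
  rw [hP14] at hfinPU hfinPp hfinUp
  have hcm : ∀ Z : Module.End ℂ W, Z * ι = ι * Z → ∀ x ∈ Um, Z x ∈ Um := fun Z hZ x hx =>
    (hUm _).2 (by rw [← Module.End.mul_apply, ← hZ, Module.End.mul_apply, (hUm x).1 hx, map_neg])
  have hcp : ∀ Z : Module.End ℂ W, Z * ι = ι * Z → ∀ x ∈ Up, Z x ∈ Up := fun Z hZ x hx =>
    (hUp _).2 (by rw [← Module.End.mul_apply, ← hZ, Module.End.mul_apply, (hUp x).1 hx])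
  have hfullm_of : Lm = ⊤ → False := fun h =>
    UnitaryLeviSetup.false_of_full_larger hbr hΘΘ hno1 hιι hιΘ hUm hUp (by omega) (by omega) hPM hQM (by omega)
      (by omega) hLm h
  have hfullp_of : Lp = ⊤ → False := by
    intro hLptop
    have hfullp : ∀ T : Module.End ℂ Up, ∃ Z ∈ 𝔊, Z * ι = ι * Z ∧ ∀ v : Up, ((T v : Up) : W) = Z v := fun T =>
      (hLp T).1 (by rw [hLptop]; exact Submodule.mem_top)
    obtain ⟨e₁, he₁, e₂, he₂, he₁0, he₂1⟩ := UnitaryPencil.exists_pair_of_two_le_finrank PU (by omega)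
    have hind : ∀ a b : ℂ, a • e₁ + b • e₂ = 0 → a = 0 ∧ b = 0 := by
      intro a b hab
      by_cases hb : b = 0
      · rw [hb, zero_smul, add_zero] at hab
        exact ⟨(smul_eq_zero.1 hab).resolve_right he₁0, hb⟩
      · exfalso
        apply he₂1
        rw [Submodule.mem_span_singleton]
        refine ⟨-(b⁻¹ * a), ?_⟩
        have : e₂ = b⁻¹ • (b • e₂) := by rw [smul_smul, inv_mul_cancel₀ hb, one_smul]
        rw [this, eq_neg_of_add_eq_zero_right hab]
        module
    obtain ⟨⟨c₁, hc₁⟩, hc₁0⟩ := Module.finrank_pos_iff_exists_ne_zero.1 (show 0 < Module.finrank ℂ QU by omega)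
    obtain ⟨B₁, hB₁, hΘB₁, hB₁Θ, hr1⟩ := UnitaryLeviFull.exists_rankOne_raise_of_maxRank hbr hΘ hΘΘ hB hΘB hBΘ hmax hιι
      hιΘ (fun w => ((hPM _).1 (LinearMap.mem_range_self B w)).1)
      (fun v hιv hΘv => LinearMap.mem_ker.1 (Submodule.mem_inf.1 ((hQM v).2 ⟨hιv, hΘv⟩)).2)
      (fun v hΘv hBv => ((hQM v).1 (Submodule.mem_inf.2 ⟨(hQ v).2 hΘv, LinearMap.mem_ker.2 hBv⟩)).1) hUp hfullp
      ((hPU e₁).1 he₁).2 ((hPU e₁).1 he₁).1 ((hPU e₂).1 he₂).2 ((hPU e₂).1 he₂).1 hind ((hQU c₁).1 hc₁).2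
      ((hQU c₁).1 hc₁).1 (fun h => hc₁0 (Subtype.ext h))
    exact hno1 B₁ hB₁ hΘB₁ hB₁Θ hr1
  -- kills in `L⁻` (type `(6 | 9)`): `j ∉ {1, 2, 4, 5}`
  have hkillm : ∀ X ∈ 𝔊, Θ * X = X → X * Θ = -X → X * ι = ι * X →
      Module.finrank ℂ (Um.map X) ≠ 1 ∧ Module.finrank ℂ (Um.map X) ≠ 2 ∧ Module.finrank ℂ (Um.map X) ≠ 4 ∧
        Module.finrank ℂ (Um.map X) ≠ 5 := by
    intro X hX hΘX hXΘ hXc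
    obtain ⟨hxmem, hιmx, hxιm, hxrk⟩ := UnitaryLeviSetup.restrict_mem hcm hLm hιmapply X hX hΘX hXΘ hXc
    have hk1 : Module.finrank ℂ (Um.map X) = 1 → False := fun hj => by
      rw [hj] at hxrk
      exact hfullm_of (UnitaryRankOneRaise.eq_top_of_rankOne_raise hbrLm hirrLm hιmmem hιmιm hPm hQm
        (s := fun v w : Um => s (v : W) w) (hsU Um) (fun v w => hsymm v w) hPmQm hdefPm hdefQm hadjLm hxmem hιmx hxιm
        hxrk (by omega) (by omega) (by omega))
    have hk : ∀ j, Module.finrank ℂ (Um.map X) = j → (j = 2 ∨ j = 4 ∨ j = 5) → False := by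
      intro j hj hjs
      rw [hj] at hxrk
      refine hfullm_of (UnitaryDoubleLevi.eq_top_of_raise_of_core hbrLm hirrLm hιmmem hιmιm hPm hQm
        (s := fun v w : Um => s (v : W) w) (hsU Um) (fun v w => hsymm v w) hPmQm hdefPm hdefQm hadjLm hxmem hιmx hxιm
        (by rw [hxrk]; omega) (by omega) (by omega)
        fun U' 𝔩' ι' P' Q' hbr𝔩' hirr𝔩' hι' hι'ι' hP' hQ' hfinP' hfinQ' hP'Q' hdefP' hdefQ' hadj𝔩' => ?_)
      rw [hxrk] at hfinP' hfinQ'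
      rcases hjs with rfl | rfl | rfl
      · -- `(2 | 7)`
        exact UnitaryTwoOdd.eq_top hbr𝔩' hirr𝔩' hι' hι'ι' hP' hQ' hfinP' ⟨3, by omega⟩
          (s := fun v w : U' => s ((v : Um) : W) w) (fun v w z => by simp only [Submodule.coe_add, hadd])
          (fun v w => hsymm _ _) hP'Q' hdefP' hdefQ' hadj𝔩'
      · -- `(4 | 5)`
        exact UnitaryFourOdd.eq_top hbr𝔩' hirr𝔩' hι' hι'ι' hP' hQ' hfinP' ⟨2, by omega⟩
          (s := fun v w : U' => s ((v : Um) : W) w) (fun v w z => by simp only [Submodule.coe_add, hadd])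
          (fun v w => hsymm _ _) hP'Q' hdefP' hdefQ' hadj𝔩'
      · -- `(5 | 4)`
        exact UnitaryFive.eq_top hbr𝔩' hirr𝔩' hι' hι'ι' hP' hQ' hfinP' (Or.inr (by omega))
          (s := fun v w : U' => s ((v : Um) : W) w) (fun v w z => by simp only [Submodule.coe_add, hadd])
          (fun v w => hsymm _ _) hP'Q' hdefP' hdefQ' hadj𝔩'
    exact ⟨hk1, fun h => hk 2 h (by omega), fun h => hk 4 h (by omega), fun h => hk 5 h (by omega)⟩
  -- kill in `L⁺` (type `(8 | 6)`): `i ≠ 3` (mirrored, core `(3 | 5)`)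
  have hkillp3 : ∀ X ∈ 𝔊, Θ * X = X → X * Θ = -X → X * ι = ι * X → Module.finrank ℂ (Up.map X) ≠ 3 := by
    intro X hX hΘX hXΘ hXc h3
    obtain ⟨hymem, hιpy, hyιp, hyrk⟩ := UnitaryLeviSetup.restrict_mem hcp hLp hιpapply X hX hΘX hXΘ hXc
    rw [h3] at hyrk
    refine hfullp_of (UnitaryDoubleLevi.eq_top_of_raise_of_core' hbrLp hirrLp hιpmem hιpιp hPp hQp
      (s := fun v w : Up => s (v : W) w) (hsU Up) (fun v w => hsymm v w) hPpQp hdefPp hdefQp hadjLp hymem hιpy hyιp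
      (by rw [hyrk]; norm_num) (by omega) (by omega)
      fun U' 𝔩' ι' P' Q' hbr𝔩' hirr𝔩' hι' hι'ι' hP' hQ' hfinP' hfinQ' hP'Q' hdefP' hdefQ' hadj𝔩' => ?_)
    rw [hyrk] at hfinP' hfinQ'
    -- `(3 | 5)`
    exact UnitaryThreeCoprime.eq_top hbr𝔩' hirr𝔩' hι' hι'ι' hP' hQ' hfinP' (by omega)
      (s := fun v w : U' => s ((v : Up) : W) w) (fun v w z => by simp only [Submodule.coe_add, hadd])
      (fun v w => hsymm _ _) hP'Q' hdefP' hdefQ' hadj𝔩'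
  -- the profiles are `(0, 0)`, `(0, 6)`, `(6, 0)`
  have hprof : ∀ X ∈ 𝔊, Θ * X = X → X * Θ = -X → X * ι = ι * X →
      (Module.finrank ℂ (Up.map X) = 0 ∧ Module.finrank ℂ (Um.map X) = 0) ∨
        (Module.finrank ℂ (Up.map X) = 0 ∧ Module.finrank ℂ (Um.map X) = 6) ∨
        (Module.finrank ℂ (Up.map X) = 6 ∧ Module.finrank ℂ (Um.map X) = 0) := by
    intro X hX hΘX hXΘ hXc
    obtain ⟨hs, hi, hi', hj, hj'⟩ := hsplit X hΘX hXΘ hXc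
    have h3 := hkillp3 X hX hΘX hXΘ hXc
    obtain ⟨hm1, hm2, hm4, hm5⟩ := hkillm X hX hΘX hXΘ hXc
    have hr := hS X hX hΘX hXΘ
    rw [hs] at hr
    omega
  -- some `X₀` moves `U⁺`; it has type `(6, 0)`
  obtain ⟨⟨p, hp⟩, hp0⟩ := Module.finrank_pos_iff_exists_ne_zero.1 (show 0 < Module.finrank ℂ PU by omega)
  obtain ⟨⟨q, hq⟩, hq0⟩ := Module.finrank_pos_iff_exists_ne_zero.1 (show 0 < Module.finrank ℂ QU by omega)
  obtain ⟨X₀, hX₀, hΘX₀, hX₀Θ, hX₀c, c, hιc, hΘc, hX₀c0⟩ :=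
    UnitaryLeviFull.exists_raise_commute_apply_ne_zero hbr hirr hΘ hΘΘ hQ hιmem hιι hιΘ hUm hUp
      ⟨p, fun h => hp0 (Subtype.ext h), ((hPU p).1 hp).1, ((hPU p).1 hp).2⟩
      ⟨q, fun h => hq0 (Subtype.ext h), ((hQU q).1 hq).1, ((hQU q).1 hq).2⟩
  have hX₀i : Module.finrank ℂ (Up.map X₀) = 6 := by
    rcases hprof X₀ hX₀ hΘX₀ hX₀Θ hX₀c with ⟨h0, -⟩ | ⟨h0, -⟩ | ⟨h6', -⟩
    · exfalso
      have hmem : X₀ c ∈ Up.map X₀ := Submodule.mem_map_of_mem ((hUp c).2 hιc)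
      rw [Submodule.finrank_eq_zero.1 h0, Submodule.mem_bot] at hmem
      exact hX₀c0 hmem
    · exfalso
      have hmem : X₀ c ∈ Up.map X₀ := Submodule.mem_map_of_mem ((hUp c).2 hιc)
      rw [Submodule.finrank_eq_zero.1 h0, Submodule.mem_bot] at hmem
      exact hX₀c0 hmem
    · exact h6'
  -- two pencils: EVERY raising `Y` commuting with `ι` vanishes on `U⁻`
  have hjall : ∀ Y ∈ 𝔊, Θ * Y = Y → Y * Θ = -Y → Y * ι = ι * Y → Module.finrank ℂ (Um.map Y) = 0 := by
    intro Y hY hΘY hYΘ hYc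
    obtain ⟨c', hc1, hc2⟩ := UnitaryGenericRank.exists_finrank_le_and_finrank_le (Y.restrict (hcm Y hYc))
      (X₀.restrict (hcm X₀ hX₀c)) (X₀.restrict (hcp X₀ hX₀c)) (Y.restrict (hcp Y hYc))
    obtain ⟨hX₁, hΘX₁, hX₁Θ, hX₁c⟩ := UnitaryLeviSetup.add_smul_raise X₀ hX₀ hΘX₀ hX₀Θ hX₀c Y hY hΘY hYΘ hYc c'
    have hi₁ := UnitaryLeviSetup.finrank_map_add_smul hcp X₀ Y hX₀c hYc c' hX₁c
    have hj₁ := UnitaryLeviSetup.finrank_map_add_smul hcm X₀ Y hX₀c hYc c' hX₁c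
    have hx₀' : Module.finrank ℂ (LinearMap.range (X₀.restrict (hcp X₀ hX₀c))) = 6 := by
      rw [UnitaryLeviRank.finrank_range_restrict, hX₀i]
    have hy : Module.finrank ℂ (LinearMap.range (Y.restrict (hcm Y hYc))) = Module.finrank ℂ (Um.map Y) :=
      UnitaryLeviRank.finrank_range_restrict _
    have hp' := hprof (X₀ + c' • Y) hX₁ hΘX₁ hX₁Θ hX₁c
    rw [hi₁, hj₁] at hp'
    omega
  -- but some raising `Y` commuting with `ι` moves `U⁻ ∩ Q` (the non-vanishing lemma for `−ι`)
  have hnι : -ι ∈ 𝔊 := Submodule.neg_mem _ hιmem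
  have hnιι : (-ι) * (-ι) = 1 := by rw [neg_mul_neg, hιι]
  have hnιΘ : (-ι) * Θ = Θ * (-ι) := by rw [neg_mul, mul_neg, hιΘ]
  have hUm' : ∀ x, x ∈ Um ↔ (-ι) x = x := fun x => by rw [hUm, LinearMap.neg_apply, neg_eq_iff_eq_neg]
  have hUp' : ∀ x, x ∈ Up ↔ (-ι) x = -x := fun x => by rw [hUp, LinearMap.neg_apply, neg_inj]
  obtain ⟨⟨u, hu⟩, hu0⟩ := Module.finrank_pos_iff_exists_ne_zero.1
    (show 0 < Module.finrank ℂ (LinearMap.range B) by omega)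
  obtain ⟨⟨d₀, hd₀⟩, hd₀0⟩ := Module.finrank_pos_iff_exists_ne_zero.1
    (show 0 < Module.finrank ℂ ↥(Q ⊓ LinearMap.ker B) by omega)
  obtain ⟨Y, hY, hΘY, hYΘ, hYc', d, hιd, hΘd, hYd⟩ :=
    UnitaryLeviFull.exists_raise_commute_apply_ne_zero hbr hirr hΘ hΘΘ hQ hnι hnιι hnιΘ hUp' hUm'
      ⟨u, fun h => hu0 (Subtype.ext h), by rw [LinearMap.neg_apply, ((hPM u).1 hu).1, neg_neg], ((hPM u).1 hu).2⟩
      ⟨d₀, fun h => hd₀0 (Subtype.ext h), by rw [LinearMap.neg_apply, ((hQM d₀).1 hd₀).1, neg_neg], ((hQM d₀).1 hd₀).2⟩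
  have hYc : Y * ι = ι * Y := by rw [mul_neg, neg_mul, neg_inj] at hYc'; exact hYc'
  have h0 := hjall Y hY hΘY hYΘ hYc
  have hmem : Y d ∈ Um.map Y := Submodule.mem_map_of_mem ((hUm' d).2 hιd)
  rw [Submodule.finrank_eq_zero.1 h0, Submodule.mem_bot] at hmem
  exact hYd hmem

/-! ### §3 The `(14 | 15)` core and its mirror -/

/-- **THE `Θ`-SUBALGEBRA THEOREM FOR UNITARY MULTIPLICITIES `(14, 15)` — complex Hermitian core, classification-free.**
`𝔊 ⊆ End(W)` bracket-closed and irreducible, `Θ ∈ 𝔊` an involution with `dim P = 14`, `dim Q = 15`, Hermitian data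
(`s` additive and `ℂ`-homogeneous in the first slot, Hermitian-symmetric, `P ⊥ Q`, definite on `P` and on `Q`), `𝔊`
adjoint-closed ⟹ `𝔊 = End(W)`. See the module docstring. [cite: Ribet1983, Thm. 3] [cite: Gordon1997, Thm. 6.3 (3)]
[cite: Deligne1982HodgeCycles, I §3 Prop. 3.4, 3.6] [cite: GoodmanWallachGTM255, §4.1.1] -/
theorem UnitaryFourteenFifteen.eq_top_of_smul [FiniteDimensional ℂ W] {𝔊 : Submodule ℂ (Module.End ℂ W)}
    (hbr : ∀ Y ∈ 𝔊, ∀ Z ∈ 𝔊, Y * Z - Z * Y ∈ 𝔊)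
    (hirr : ∀ U : Submodule ℂ W, (∀ A ∈ 𝔊, ∀ u ∈ U, A u ∈ U) → U = ⊥ ∨ U = ⊤)
    {Θ : Module.End ℂ W} (hΘ : Θ ∈ 𝔊) (hΘΘ : Θ * Θ = 1)
    {P Q : Submodule ℂ W} (hP : ∀ x, x ∈ P ↔ Θ x = x) (hQ : ∀ x, x ∈ Q ↔ Θ x = -x)
    (hP14 : Module.finrank ℂ P = 14) (hQ15 : Module.finrank ℂ Q = 15)
    {s : W → W → ℂ} (hadd : ∀ x y z, s (x + y) z = s x z + s y z)
    (hsmul : ∀ (c : ℂ) (x y : W), s (c • x) y = c * s x y) (hsymm : ∀ x y, s y x = starRingEnd ℂ (s x y))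
    (hPQ : ∀ p ∈ P, ∀ q ∈ Q, s p q = 0) (hdefP : ∀ p ∈ P, s p p = 0 → p = 0) (hdefQ : ∀ q ∈ Q, s q q = 0 → q = 0)
    (hadj : ∀ X ∈ 𝔊, ∃ Y ∈ 𝔊, ∀ x y, s (X x) y = s x (Y y)) : 𝔊 = ⊤ := by
  classical
  have hraiseval : ∀ Z : Module.End ℂ W, Θ * Z = Z → ∀ w, Z w ∈ P := fun Z hΘZ w =>
    (hP _).2 (by rw [← Module.End.mul_apply, hΘZ])
  have hle14 : ∀ B' : Module.End ℂ W, Θ * B' = B' → Module.finrank ℂ (LinearMap.range B') ≤ 14 := fun B' h => by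
    rw [← hP14]
    exact Submodule.finrank_mono (by rintro _ ⟨w, rfl⟩; exact hraiseval B' h w)
  have hsU : ∀ U : Submodule ℂ W, ∀ x y z : U, s ((x + y : U) : W) z = s (x : W) z + s (y : W) z :=
    fun U x y z => by simp only [Submodule.coe_add, hadd]
  have hsmU : ∀ U : Submodule ℂ W, ∀ (c : ℂ) (x y : U), s ((c • x : U) : W) y = c * s (x : W) y :=
    fun U c x y => by simp only [Submodule.coe_smul, hsmul]
  -- STEP 1: the good ranks `1, 2, 4, 7, 8, 11, 13, 14`
  have key : ∀ B' ∈ 𝔊, Θ * B' = B' → B' * Θ = -B' →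
      (Module.finrank ℂ (LinearMap.range B') = 1 ∨ Module.finrank ℂ (LinearMap.range B') = 2 ∨
        Module.finrank ℂ (LinearMap.range B') = 4 ∨ Module.finrank ℂ (LinearMap.range B') = 7 ∨
        Module.finrank ℂ (LinearMap.range B') = 8 ∨ Module.finrank ℂ (LinearMap.range B') = 11 ∨
        Module.finrank ℂ (LinearMap.range B') = 13 ∨ Module.finrank ℂ (LinearMap.range B') = 14) → 𝔊 = ⊤ := by
    intro B' hB' hΘB' hB'Θ hr
    refine UnitaryDoubleLevi.eq_top_of_raise_of_core hbr hirr hΘ hΘΘ hP hQ hadd hsymm hPQ hdefP hdefQ hadj hB' hΘB' hB'Θ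
      (by omega) (by omega) (by omega)
      fun U 𝔩 ι P' Q' hbr𝔩 hirr𝔩 hι hιι hP' hQ' hfinP' hfinQ' hP'Q' hdefP' hdefQ' hadj𝔩 => ?_
    rw [hQ15] at hfinQ'
    rcases hr with h | h | h | h | h | h | h | h <;> rw [h] at hfinP' hfinQ'
    · -- `(1 | 14)`: the `(m, 1)` core for `−ι`
      exact UnitaryThreeCoprime.eq_top_of_finrank_eq_one hbr𝔩 hirr𝔩 (Submodule.neg_mem _ hι)
        ((neg_mul_neg ι ι).trans hιι) (P := Q') (Q := P') (fun x => by rw [hQ', LinearMap.neg_apply, neg_eq_iff_eq_neg])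
        (fun x => by rw [hP', LinearMap.neg_apply, neg_inj]) (by omega) hfinP'
    · -- `(2 | 13)`
      exact UnitaryTwoOdd.eq_top hbr𝔩 hirr𝔩 hι hιι hP' hQ' hfinP' ⟨6, by omega⟩ (s := fun x y : U => s (x : W) y)
        (hsU U) (fun x y => hsymm x y) hP'Q' hdefP' hdefQ' hadj𝔩
    · -- `(4 | 11)`
      exact UnitaryFourOdd.eq_top hbr𝔩 hirr𝔩 hι hιι hP' hQ' hfinP' ⟨5, by omega⟩ (s := fun x y : U => s (x : W) y)
        (hsU U) (fun x y => hsymm x y) hP'Q' hdefP' hdefQ' hadj𝔩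
    · -- `(7 | 8)`
      exact UnitarySeven.eq_top_of_smul hbr𝔩 hirr𝔩 hι hιι hP' hQ' hfinP' (by omega) (s := fun x y : U => s (x : W) y)
        (hsU U) (hsmU U) (fun x y => hsymm x y) hP'Q' hdefP' hdefQ' hadj𝔩
    · -- `(8 | 7)`
      exact UnitaryEight.eq_top_of_smul hbr𝔩 hirr𝔩 hι hιι hP' hQ' hfinP' ⟨3, by omega⟩ (by omega) (by omega)
        (s := fun x y : U => s (x : W) y) (hsU U) (hsmU U) (fun x y => hsymm x y) hP'Q' hdefP' hdefQ' hadj𝔩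
    · -- `(11 | 4)`
      exact UnitaryFourCoprime.eq_top_eleven' hbr𝔩 hirr𝔩 hι hιι hP' hQ' hfinP' (by omega)
        (s := fun x y : U => s (x : W) y) (hsU U) (fun x y => hsymm x y) hP'Q' hdefP' hdefQ' hadj𝔩
    · -- `(13 | 2)`
      exact UnitaryTwoOdd.eq_top' hbr𝔩 hirr𝔩 hι hιι hP' hQ' ⟨6, by omega⟩ (by omega) (s := fun x y : U => s (x : W) y)
        (hsU U) (fun x y => hsymm x y) hP'Q' hdefP' hdefQ' hadj𝔩
    · -- `(14 | 1)`
      exact UnitaryThreeCoprime.eq_top_of_finrank_eq_one hbr𝔩 hirr𝔩 hι hιι hP' hQ' (by omega) (by omega)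
  -- STEP 2: otherwise every raising operator has rank in `{0, 3, 5, 6, 9, 10, 12}`
  by_contra hne
  have hbad : ∀ B' ∈ 𝔊, Θ * B' = B' → B' * Θ = -B' →
      Module.finrank ℂ (LinearMap.range B') = 0 ∨ Module.finrank ℂ (LinearMap.range B') = 3 ∨
        Module.finrank ℂ (LinearMap.range B') = 5 ∨ Module.finrank ℂ (LinearMap.range B') = 6 ∨
        Module.finrank ℂ (LinearMap.range B') = 9 ∨ Module.finrank ℂ (LinearMap.range B') = 10 ∨
        Module.finrank ℂ (LinearMap.range B') = 12 := by
    intro B' hB' hΘB' hB'Θ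
    have h14 := hle14 B' hΘB'
    have hk : ¬ (Module.finrank ℂ (LinearMap.range B') = 1 ∨ Module.finrank ℂ (LinearMap.range B') = 2 ∨
        Module.finrank ℂ (LinearMap.range B') = 4 ∨ Module.finrank ℂ (LinearMap.range B') = 7 ∨
        Module.finrank ℂ (LinearMap.range B') = 8 ∨ Module.finrank ℂ (LinearMap.range B') = 11 ∨
        Module.finrank ℂ (LinearMap.range B') = 13 ∨ Module.finrank ℂ (LinearMap.range B') = 14) :=
      fun h => hne (key B' hB' hΘB' hB'Θ h)
    omega
  -- STEP 3: the six Levi-pair steps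
  have hno9 : ∀ B ∈ 𝔊, Θ * B = B → B * Θ = -B → Module.finrank ℂ (LinearMap.range B) ≠ 9 :=
    fun B hB hΘB hBΘ h9 => UnitaryFourteenFifteen.no_rank_nine hbr hirr hΘ hΘΘ hP hQ hP14 hQ15 hadd hsymm hPQ hdefP hdefQ hadj hbad hB hΘB hBΘ h9
  have hno5 : ∀ B ∈ 𝔊, Θ * B = B → B * Θ = -B → Module.finrank ℂ (LinearMap.range B) ≠ 5 :=
    fun B hB hΘB hBΘ h5 => UnitaryFourteenFifteen.no_rank_five hbr hirr hΘ hΘΘ hP hQ hP14 hQ15 hadd hsmul hsymm hPQ hdefP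
      hdefQ hadj hbad hB hΘB hBΘ h5
  have hbad₂ : ∀ B' ∈ 𝔊, Θ * B' = B' → B' * Θ = -B' →
      Module.finrank ℂ (LinearMap.range B') = 0 ∨ Module.finrank ℂ (LinearMap.range B') = 3 ∨
        Module.finrank ℂ (LinearMap.range B') = 6 ∨ Module.finrank ℂ (LinearMap.range B') = 10 ∨
        Module.finrank ℂ (LinearMap.range B') = 12 := by
    intro B' hB' hΘB' hB'Θ
    have h5 := hno5 B' hB' hΘB' hB'Θ
    have h9 := hno9 B' hB' hΘB' hB'Θ
    rcases hbad B' hB' hΘB' hB'Θ with h | h | h | h | h | h | h <;> omega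
  -- raising pencils
  have hno3 : ∀ A ∈ 𝔊, Θ * A = A → A * Θ = -A → Module.finrank ℂ (LinearMap.range A) ≠ 3 :=
    fun A hA hΘA hAΘ h3 => UnitaryFourteenFifteen.no_rank_three hbr hirr hΘ hΘΘ hP hQ hP14 hadd hsymm hPQ hdefP hdefQ hadj
      hbad₂ hA hΘA hAΘ h3
  have hbad₃ : ∀ B' ∈ 𝔊, Θ * B' = B' → B' * Θ = -B' →
      Module.finrank ℂ (LinearMap.range B') = 0 ∨ Module.finrank ℂ (LinearMap.range B') = 6 ∨
        Module.finrank ℂ (LinearMap.range B') = 10 ∨ Module.finrank ℂ (LinearMap.range B') = 12 := by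
    intro B' hB' hΘB' hB'Θ
    have h3 := hno3 B' hB' hΘB' hB'Θ
    rcases hbad₂ B' hB' hΘB' hB'Θ with h | h | h | h | h <;> omega
  have hno12 : ∀ B ∈ 𝔊, Θ * B = B → B * Θ = -B → Module.finrank ℂ (LinearMap.range B) ≠ 12 :=
    fun B hB hΘB hBΘ h12 => UnitaryFourteenFifteen.no_rank_twelve hbr hirr hΘ hΘΘ hP hQ hP14 hQ15 hadd hsymm hPQ hdefP hdefQ hadj hbad₃ hB hΘB hBΘ h12
  have hbad₄ : ∀ B' ∈ 𝔊, Θ * B' = B' → B' * Θ = -B' →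
      Module.finrank ℂ (LinearMap.range B') = 0 ∨ Module.finrank ℂ (LinearMap.range B') = 6 ∨
        Module.finrank ℂ (LinearMap.range B') = 10 := by
    intro B' hB' hΘB' hB'Θ
    have h12 := hno12 B' hB' hΘB' hB'Θ
    rcases hbad₃ B' hB' hΘB' hB'Θ with h | h | h | h <;> omega
  have hno10 : ∀ B ∈ 𝔊, Θ * B = B → B * Θ = -B → Module.finrank ℂ (LinearMap.range B) ≠ 10 :=
    fun B hB hΘB hBΘ h10 => UnitaryFourteenFifteen.no_rank_ten hbr hirr hΘ hΘΘ hP hQ hP14 hQ15 hadd hsymm hPQ hdefP hdefQ hadj hbad₄ hB hΘB hBΘ h10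
  have hbad₅ : ∀ B' ∈ 𝔊, Θ * B' = B' → B' * Θ = -B' →
      Module.finrank ℂ (LinearMap.range B') = 0 ∨ Module.finrank ℂ (LinearMap.range B') = 6 := by
    intro B' hB' hΘB' hB'Θ
    have h10 := hno10 B' hB' hΘB' hB'Θ
    rcases hbad₄ B' hB' hΘB' hB'Θ with h | h | h <;> omega
  exact UnitaryFourteenFifteen.false_of_rank_zero_or_six hbr hirr hΘ hΘΘ hP hQ hP14 hQ15 hadd hsymm hPQ hdefP hdefQ hadj hbad₅

/-- **The mirror core `(15, 14)`** (apply `eq_top_of_smul` to `−Θ`). [cite: Ribet1983, Thm. 3]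
[cite: Gordon1997, Thm. 6.3 (3)] -/
theorem UnitaryFourteenFifteen.eq_top_of_smul' [FiniteDimensional ℂ W] {𝔊 : Submodule ℂ (Module.End ℂ W)}
    (hbr : ∀ Y ∈ 𝔊, ∀ Z ∈ 𝔊, Y * Z - Z * Y ∈ 𝔊)
    (hirr : ∀ U : Submodule ℂ W, (∀ A ∈ 𝔊, ∀ u ∈ U, A u ∈ U) → U = ⊥ ∨ U = ⊤)
    {Θ : Module.End ℂ W} (hΘ : Θ ∈ 𝔊) (hΘΘ : Θ * Θ = 1)
    {P Q : Submodule ℂ W} (hP : ∀ x, x ∈ P ↔ Θ x = x) (hQ : ∀ x, x ∈ Q ↔ Θ x = -x)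
    (hP15 : Module.finrank ℂ P = 15) (hQ14 : Module.finrank ℂ Q = 14)
    {s : W → W → ℂ} (hadd : ∀ x y z, s (x + y) z = s x z + s y z)
    (hsmul : ∀ (c : ℂ) (x y : W), s (c • x) y = c * s x y) (hsymm : ∀ x y, s y x = starRingEnd ℂ (s x y))
    (hPQ : ∀ p ∈ P, ∀ q ∈ Q, s p q = 0) (hdefP : ∀ p ∈ P, s p p = 0 → p = 0) (hdefQ : ∀ q ∈ Q, s q q = 0 → q = 0)
    (hadj : ∀ X ∈ 𝔊, ∃ Y ∈ 𝔊, ∀ x y, s (X x) y = s x (Y y)) : 𝔊 = ⊤ := by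
  have hnΘ : -Θ ∈ 𝔊 := Submodule.neg_mem _ hΘ
  have hnΘΘ : (-Θ) * (-Θ) = 1 := by rw [neg_mul_neg, hΘΘ]
  exact UnitaryFourteenFifteen.eq_top_of_smul hbr hirr hnΘ hnΘΘ (P := Q) (Q := P)
    (fun x => by rw [hQ, LinearMap.neg_apply, neg_eq_iff_eq_neg]) (fun x => by rw [hP, LinearMap.neg_apply, neg_inj])
    hQ14 hP15 hadd hsmul hsymm (fun p hp q hq => by rw [hsymm, hPQ q hq p hp, map_zero]) hdefQ hdefP hadj

end HodgeStructure

end Literature.AlgebraicGeometry.Motives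

end
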